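import Literature.MathematicalPhysics.QuantumLattice.HubbardTorusFreeFermionExactEnergy
import Literature.MathematicalPhysics.QuantumLattice.HubbardChainEnergyDensityAt
import Mathlib.Analysis.SumIntegralComparisons
import HarnessLib

/-!
# The Hubbard chain at `U = 0`: `e(t, 0) = -4t/π` at half filling and `-(4t/π) sin(πn/2)` at every filling (free fermions)

Topic `MathematicalPhysics/QuantumLattice`, family `hubbard`. The tree's thermodynamic-limit energy
density of the half-filled Hubbard ring, `ThermodynamicLimit.hubbardChainEnergyDensity t U = lim_L E_L(L)/L`
(`HubbardChainEnergyDensity.lean`), is identified with the Lieb–Wu Bethe-ansatz energy only for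
`U > 0` and only conditionally on the named fact `lieb_wu` (`hubbardChainEnergyDensity_eq_liebWuEnergy`).
This file PROVES, unconditionally, its free-fermion endpoint

  `hubbardChainEnergyDensity t 0 = -4t/π`    (`t ≥ 0`; `FreeFermionChain.hubbardChainEnergyDensity_zero`),
  `hubbardChainEnergyDensityAt t 0 1 2 = -2√2·t/π`    (quarter filling; `hubbardChainEnergyDensityAt_zero_half`),
  `hubbardChainEnergyDensityAt t 0 p q = -(4t/π) sin(πp/(2q))`    (every filling `1 ≤ p ≤ 2q`;
                                                                   `hubbardChainEnergyDensityAt_zero`),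

the `U = 0` value of Lieb–Wu's energy: Physica A 321 (2003) §4, `E = -2N_a ∫_{-Q}^{Q} ρ(k) cos k dk`,
with §6 Remark (A), `ρ₀(k) = 1/π` for `|k| ≤ π/2` at `U = 0` ("what is expected for an ideal Fermi
gas"), i.e. `E/N_a = -4/π` at `t = 1` [LiebWuPhysicaA2003]; the 1968 Letter states the energy formula as
eq. (20) [LiebWuPRL1968]. On the way, for finite rings at `U = 0` (all PROVED):

* `hubbardChain_groundEnergyAt_zero_ge`: on every ring `L ≥ 3`, every `N ≤ 2L`,
  `E_L(N) ≥ -4t (L/π + 1)` — the Lieb–Loss bathtub bound (`FreeKinetic.hubbardTorus_groundEnergyAt_ge`,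
  [LiebLoss1993, §8 Thm 8.2]) at Fermi level `0`, `E_L(N) ≥ -4t Σ_{j<L} max(cos(2πj/L), 0)`, and the
  Riemann-sum estimate `Σ_{j<L} max(cos(2πj/L), 0) ≤ L/π + 1` (§A);
* `hubbardChain_groundEnergyAt_zero_eq`: the EXACT half-filled energy of every even ring `L = 2n ≥ 4`,
  `E_L(L) = -4t Σ_{j ∈ [0,⌈n/2⌉) ∪ [2n-⌊n/2⌋,2n)} cos(2πj/L)` (the doubly filled Fermi sea
  `{cos k ≥ 0}` less one zero mode; an instance of the tree's
  `FreeFermionTorus.hubbardTorus_groundEnergyAt_zero_eq_two_mul`, bathtub = Slater);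
* `hubbardChain_groundEnergyAt_zero_le`: on the rings `L = 4m`, `E_L(L) ≤ -4t (L/π - 1)` (the Fermi-sea
  sum is `2 Σ_{j<m} cos(πj/2m) - 1 ≥ 4m/π - 1`, left Riemann sum of an antitone function).

* §D, `hubbardChain{4,6,8,10,12,16}_groundEnergyAt_zero`: the kernel-exact values
  `E_4(4) = -4t`, `E_6(6) = -8t`, `E_8(8) = -4t(1+√2)`, `E_10(10) = -4t(1+√5)`, `E_12(12) = -4t(2+√3)`,
  `E_16(16) = -4t(1+√2+√(2+√2)+√(2-√2))` (closed trigonometric sums), and `hubbardChainEnergyDensity_one_zero`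
  (`e(1,0) = -4/π`).

* §E (quarter filling, `n = 1/2`): `hubbardChainEnergyDensityAt_zero_half :
  hubbardChainEnergyDensityAt t 0 1 2 = -2√2·t/π` (`= -(4t/π) sin(πn/2)` at `n = 1/2`), from the
  bathtub bound at the Fermi level `μ = -√2 t` on every ring (`hubbardChain_groundEnergyAt_zero_ge_quarter`,
  Riemann estimate for the threshold `cos k - √2/2`), the exact Fermi-sea energy of the rings `L = 8m`,
  `N = 4m` (`hubbardChain_groundEnergyAt_zero_quarter_eq`) and its Riemann bound (`_quarter_le`), through
  the tree's `hubbardChainEnergyDensityAt_le_of_le` / `_ge_of_forall_ge` (`HubbardChainEnergyDensityAt.lean`).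

* §F (every rational filling `n = p/q`, `1 ≤ p ≤ 2q`): `hubbardChainEnergyDensityAt_zero :
  hubbardChainEnergyDensityAt t 0 p q = -(4t/π) sin(πp/(2q))` — Fermi momentum `k_F = πn/2`; the bathtub
  bound at an arbitrary trial Fermi momentum `a ∈ [0, π]` on every ring
  (`hubbardChain_groundEnergyAt_zero_ge_fermi`: `E_L(N) ≥ -2t cos(a) N - 4t(L(sin a - a cos a)/π + 1 - cos a)`),
  the exact Fermi-sea energy of the rings `L = 4qm'`, `N = 4pm'` (`hubbardChain_groundEnergyAt_zero_filling_eq`)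
  with its Riemann bound (`_filling_le`), and the limit (`μn` cancels against `(4t/π) k_F cos k_F`).

The limit then follows from the tree's two transfer lemmas `hubbardChainEnergyDensity_le_of_le`
(`e ≤ E_L(L)/L + 8|t|/L`, subadditivity [Ruelle1969, §2.2]) and `hubbardChainEnergyDensity_ge_of_forall_ge`.
The sign restriction `t ≥ 0` is the physical case; on even rings `t ↦ -t` is a gauge transformation
(not used here).

## References

* E. H. Lieb, F. Y. Wu, Physica A 321 (2003) 1–27 = arXiv:cond-mat/0207529 (held; key
  `LiebWuPhysicaA2003`): §4 (ground-state energy `E(M,M') = -2N_a∫ρ cos k`), §6 Remark (A) (`U = 0`).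
* E. H. Lieb, F. Y. Wu, Phys. Rev. Lett. 20 (1968) 1445–1448, eq. (20). [LiebWuPRL1968]
* E. H. Lieb, M. Loss, Analysis (AMS GSM 14), §8 Theorem 8.2 (bathtub). [LiebLoss1993]
* D. Ruelle, Statistical Mechanics: Rigorous Results (1969), §2.2. [Ruelle1969]

## Mathlib / tree search

Tree (REUSED): `FreeFermionTorus.hubbardTorus_groundEnergyAt_zero_eq_two_mul`
(`HubbardTorusFreeFermionExactEnergy.lean`), `FreeKinetic.hubbardTorus_groundEnergyAt_ge`,
`HartreeFock.siteBand_neg_ofTorusSite(_eq_sdwBand)`, `latticeMomentum`,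
`ThermodynamicLimit.hubbardChainEnergyDensity_le_of_le`, `hubbardChainEnergyDensity_ge_of_forall_ge`,
`hubbardChainEnergyDensityAt_le_of_le`, `hubbardChainEnergyDensityAt_ge_of_forall_ge`.
Mathlib: `AntitoneOn.integral_le_sum`, `AntitoneOn.sum_le_integral` (`Mathlib.Analysis.SumIntegralComparisons`),
`intervalIntegral.integral_comp_mul_left`, `integral_cos`, `Finset.sum_Ico_reflect`, `Finset.sum_nbij`,
`ZMod.val_cast_of_lt`, `ZMod.natCast_zmod_val`, `Real.cos_nonneg_of_neg_pi_div_two_le_of_le`,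
`Real.cos_nonpos_of_pi_div_two_le_of_le`, `le_of_forall_pos_le_add`. `lean search` found no tree
statement of the value `-4t/π` (the chain files record `lieb_wu` for `U > 0` only).
-/

noncomputable section

namespace Literature.MathematicalPhysics.QuantumLattice

namespace FreeFermionChain

open Real MeasureTheory intervalIntegral Set Finset Filter Topology
  Literature.Probability.LatticeModels
  Literature.MathematicalPhysics.QuantumLattice.HartreeFock
  Literature.MathematicalPhysics.QuantumLattice.FreeKinetic
  Literature.MathematicalPhysics.QuantumLattice.ThermodynamicLimit

/-! ### §A An elementary Riemann-sum bound: `Σ_{j<L} max(cos(2πj/L), 0) ≤ L/π + 1` -/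

/-- `∫₀^π max(cos x, 0) dx = 1`. [folklore] -/
private theorem integral_max_cos_zero_pi : ∫ x in (0:ℝ)..π, max (Real.cos x) 0 = 1 := by
  have hsplit : ∫ x in (0:ℝ)..π, max (Real.cos x) 0 =
      (∫ x in (0:ℝ)..(π/2), max (Real.cos x) 0) + ∫ x in (π/2)..π, max (Real.cos x) 0 := by
    rw [integral_add_adjacent_intervals]
    · exact (Continuous.max Real.continuous_cos continuous_const).intervalIntegrable _ _
    · exact (Continuous.max Real.continuous_cos continuous_const).intervalIntegrable _ _
  have h1 : ∫ x in (0:ℝ)..(π/2), max (Real.cos x) 0 = ∫ x in (0:ℝ)..(π/2), Real.cos x := by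
    refine integral_congr fun x hx => ?_
    rw [Set.uIcc_of_le (by positivity)] at hx
    exact max_eq_left (Real.cos_nonneg_of_mem_Icc ⟨by linarith [hx.1, Real.pi_pos], hx.2⟩)
  have h2 : ∫ x in (π/2)..π, max (Real.cos x) 0 = ∫ x in (π/2)..π, (0:ℝ) := by
    refine integral_congr fun x hx => ?_
    rw [Set.uIcc_of_le (by linarith [Real.pi_pos])] at hx
    exact max_eq_right (Real.cos_nonpos_of_pi_div_two_le_of_le hx.1 (by linarith [hx.2, Real.pi_pos]))
  rw [hsplit, h1, h2, integral_cos, intervalIntegral.integral_zero]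
  simp

/-- For `0 < θ`, `0 ≤ a` with `aθ ≤ π`: `∫₀^a max(cos(θu), 0) du ≤ 1/θ`. [folklore] -/
private theorem integral_max_cos_mul_le {θ : ℝ} (hθ : 0 < θ) {a : ℝ} (ha0 : 0 ≤ a) (ha : θ * a ≤ π) :
    ∫ u in (0:ℝ)..a, max (Real.cos (θ * u)) 0 ≤ 1 / θ := by
  have hsub : ∫ u in (0:ℝ)..a, max (Real.cos (θ * u)) 0 =
      θ⁻¹ * ∫ x in (0:ℝ)..(θ * a), max (Real.cos x) 0 := by
    have h := intervalIntegral.integral_comp_mul_left (fun x => max (Real.cos x) 0) (hθ.ne') (a := 0) (b := a)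
    simpa using h
  have hmono : ∫ x in (0:ℝ)..(θ * a), max (Real.cos x) 0 ≤ ∫ x in (0:ℝ)..π, max (Real.cos x) 0 := by
    refine intervalIntegral.integral_mono_interval le_rfl (by positivity) ha ?_ ?_
    · exact Filter.Eventually.of_forall fun x => le_max_right _ _
    · exact (Continuous.max Real.continuous_cos continuous_const).intervalIntegrable _ _
  have hmono' : ∫ x in (0:ℝ)..(θ * a), max (Real.cos x) 0 ≤ 1 := by
    rw [← integral_max_cos_zero_pi]; exact hmono
  rw [hsub]
  calc θ⁻¹ * ∫ x in (0:ℝ)..(θ * a), max (Real.cos x) 0 ≤ θ⁻¹ * 1 :=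
        mul_le_mul_of_nonneg_left hmono' (inv_nonneg.2 hθ.le)
    _ = 1 / θ := by ring

/-- Unit-step Riemann sum of the antitone function `u ↦ max(cos(θu),0)` on `[0, J]`, `Jθ ≤ π`:
`Σ_{i<J} max(cos(θ(i+1)), 0) ≤ 1/θ`. [folklore] -/
private theorem sum_max_cos_succ_le {θ : ℝ} (hθ : 0 < θ) (J : ℕ) (hJ : θ * J ≤ π) :
    ∑ i ∈ Finset.range J, max (Real.cos (θ * ((i : ℕ) + 1 : ℕ))) 0 ≤ 1 / θ := by
  have hanti : AntitoneOn (fun u : ℝ => max (Real.cos (θ * u)) 0) (Icc (0:ℝ) (0 + J)) := by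
    intro x hx y hy hxy
    simp only [zero_add] at hx hy
    refine max_le_max ?_ le_rfl
    apply Real.cos_le_cos_of_nonneg_of_le_pi (by nlinarith [hx.1, hθ.le])
      (le_trans (mul_le_mul_of_nonneg_left hy.2 hθ.le) hJ) (mul_le_mul_of_nonneg_left hxy hθ.le)
  have h := hanti.sum_le_integral
  simp only [zero_add] at h
  calc ∑ i ∈ Finset.range J, max (Real.cos (θ * ((i : ℕ) + 1 : ℕ))) 0
      = ∑ i ∈ Finset.range J, max (Real.cos (θ * ((i : ℝ) + 1))) 0 := by
        refine Finset.sum_congr rfl fun i _ => ?_; push_cast; ring_nf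
    _ ≤ ∫ u in (0:ℝ)..(J:ℝ), max (Real.cos (θ * u)) 0 := by simpa using h
    _ ≤ 1 / θ := integral_max_cos_mul_le hθ (Nat.cast_nonneg J) hJ

/-- **`Σ_{j<L} max(cos(2πj/L), 0) ≤ L/π + 1`** for every `L ≥ 1`: the positive part of the cosine
band summed over the `L` ring momenta is at most its Riemann integral `L/π` plus one (split the circle
at `π`; `max(cos,0)` is antitone on `[0,π]`, and the arc `(π,2π)` is the reflection `j ↦ L - j`).
[folklore] -/
private theorem sum_range_max_cos_le (L : ℕ) (hL : 1 ≤ L) :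
    ∑ j ∈ Finset.range L, max (Real.cos (2 * π * j / L)) 0 ≤ L / π + 1 := by
  have hLpos : (0:ℝ) < L := by exact_mod_cast hL
  set θ : ℝ := 2 * π / L with hθdef
  have hθ : 0 < θ := by positivity
  have hθL : θ * L = 2 * π := by rw [hθdef]; field_simp
  have hinvθ : 1 / θ = L / (2 * π) := by rw [hθdef]; field_simp
  -- rewrite the summand as `max(cos(θ j), 0)`
  have hsummand : ∀ j : ℕ, Real.cos (2 * π * j / L) = Real.cos (θ * j) := fun j => by
    rw [hθdef]; ring_nf
  simp_rw [hsummand]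
  -- split `range L` at `J + 1`, `J = L / 2`
  set J : ℕ := L / 2 with hJdef
  have hJL : J + 1 ≤ L := by omega
  obtain ⟨M, hM⟩ : ∃ M, L = (J + 1) + M := ⟨L - (J + 1), by omega⟩
  have hJθ : θ * J ≤ π := by
    have h2J : (2 * J : ℕ) ≤ L := by omega
    have : θ * J = π * ((2 * J : ℕ) / (L : ℝ)) := by rw [hθdef]; push_cast; field_simp
    rw [this]
    have hle : ((2 * J : ℕ) : ℝ) / L ≤ 1 := by
      rw [div_le_one hLpos]; exact_mod_cast h2J
    nlinarith [Real.pi_pos]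
  have hMθ : θ * M ≤ π := by
    have h2M : (2 * M : ℕ) ≤ L := by omega
    have : θ * M = π * ((2 * M : ℕ) / (L : ℝ)) := by rw [hθdef]; push_cast; field_simp
    rw [this]
    have hle : ((2 * M : ℕ) : ℝ) / L ≤ 1 := by
      rw [div_le_one hLpos]; exact_mod_cast h2M
    nlinarith [Real.pi_pos]
  have hsplit : ∑ j ∈ Finset.range L, max (Real.cos (θ * j)) 0 =
      ∑ j ∈ Finset.range (J + 1), max (Real.cos (θ * j)) 0 +
        ∑ i ∈ Finset.range M, max (Real.cos (θ * ((J + 1 + i : ℕ) : ℝ))) 0 := by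
    rw [hM, Finset.sum_range_add]
  -- first block: `j = 0, …, J`
  have hA : ∑ j ∈ Finset.range (J + 1), max (Real.cos (θ * j)) 0 ≤ 1 + 1 / θ := by
    rw [Finset.sum_range_succ']
    have h0 : max (Real.cos (θ * ((0:ℕ) : ℝ))) 0 = 1 := by simp
    rw [h0]
    have h1 := sum_max_cos_succ_le hθ J hJθ
    have : ∑ i ∈ Finset.range J, max (Real.cos (θ * ((i + 1 : ℕ) : ℝ))) 0 ≤ 1 / θ := by
      simpa using h1
    linarith
  -- second block: `j = J+1, …, L-1`, reflected to `i = 1, …, M`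
  have hB : ∑ i ∈ Finset.range M, max (Real.cos (θ * ((J + 1 + i : ℕ) : ℝ))) 0 ≤ 1 / θ := by
    have hrefl : ∑ i ∈ Finset.range M, max (Real.cos (θ * ((J + 1 + i : ℕ) : ℝ))) 0 =
        ∑ i ∈ Finset.range M, max (Real.cos (θ * ((i : ℕ) + 1 : ℕ))) 0 := by
      rw [← Finset.sum_range_reflect (fun i => max (Real.cos (θ * ((i : ℕ) + 1 : ℕ))) 0) M]
      refine Finset.sum_congr rfl fun i hi => ?_
      have hiM : i < M := Finset.mem_range.mp hi
      -- `θ (J+1+i) = 2π - θ (M-1-i+1)`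
      have hid : ((J + 1 + i : ℕ) : ℝ) = L - ((M - 1 - i : ℕ) + 1 : ℕ) := by
        have : (M - 1 - i : ℕ) + 1 + (J + 1 + i) = L := by omega
        have h' : (((M - 1 - i : ℕ) + 1 : ℕ) : ℝ) + ((J + 1 + i : ℕ) : ℝ) = L := by exact_mod_cast this
        linarith
      rw [hid, mul_sub, hθL,
        show 2 * π - θ * (((M - 1 - i : ℕ) + 1 : ℕ) : ℝ) = -(θ * (((M - 1 - i : ℕ) + 1 : ℕ) : ℝ) - 2 * π) by ring,
        Real.cos_neg, Real.cos_sub_two_pi]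
    rw [hrefl]
    exact sum_max_cos_succ_le hθ M hMθ
  have htot : (1 + 1 / θ) + 1 / θ = L / π + 1 := by rw [hinvθ]; ring
  rw [hsplit]
  linarith [hA, hB]


/-! ### §B Finite rings at `U = 0`: the bathtub lower bound, the exact Fermi-sea energy of the
half-filled even ring, and a Riemann upper bound on the rings `L = 4m` -/

variable {L : ℕ}

/-- Transport of a sum over `ℤ/Lℤ` to the representatives `0, …, L-1`. [folklore] -/
private theorem sum_zmod_val_eq_sum_range (L : ℕ) [NeZero L] (g : ℕ → ℝ) :
    ∑ a : ZMod L, g a.val = ∑ j ∈ Finset.range L, g j := by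
  refine Finset.sum_nbij (fun a : ZMod L => a.val) (fun a _ => Finset.mem_range.2 (ZMod.val_lt a))
    (fun a _ b _ h => ZMod.val_injective L h) ?_ (fun a _ => rfl)
  intro j hj
  have hj' : j < L := Finset.mem_range.1 (Finset.mem_coe.1 hj)
  exact ⟨(j : ZMod L), Finset.mem_coe.2 (Finset.mem_univ _), ZMod.val_cast_of_lt hj'⟩

/-- A sum over the ring momenta `(ℤ/Lℤ)^1` of a function of the representative is a sum over
`0, …, L-1`. [folklore] -/
private theorem sum_torusSite_one_eq_sum_range (L : ℕ) [NeZero L] (g : ℕ → ℝ) :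
    ∑ z : TorusSite 1 L, g (z 0).val = ∑ j ∈ Finset.range L, g j := by
  rw [← sum_zmod_val_eq_sum_range L g]
  exact Fintype.sum_equiv (Equiv.funUnique (Fin 1) (ZMod L)) _ _ fun z => rfl

/-- `min(-(t·2c), 0) = -2t·max(c, 0)` for `t ≥ 0`. [folklore] -/
private theorem min_neg_level_eq {t : ℝ} (ht : 0 ≤ t) (c : ℝ) :
    min (-(t * (2 * c))) 0 = -(2 * t) * max c 0 := by
  rcases le_total c 0 with hc | hc
  · rw [max_eq_right hc, mul_zero, min_eq_right (by nlinarith)]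
  · rw [max_eq_left hc, min_eq_left (by nlinarith)]; ring

/-- The plane-wave level `ε_k = -2t cos(2πk/L)` of the ring, read off the representative of `k`.
[folklore] -/
private theorem level_eq [NeZero L] (t : ℝ) (k : TorusSite 1 L) :
    t * (2 * ∑ i, Real.cos (latticeMomentum L k i)) = 2 * t * Real.cos (2 * π * ((k 0).val : ℕ) / L) := by
  simp only [Fin.sum_univ_one, latticeMomentum]; ring

/-- **Free-fermion (bathtub) lower bound on every ring.** For `L ≥ 3`, `t ≥ 0`, `U = 0` and every
electron number `N ≤ 2L`:
`E_L(N) ≥ -4t · Σ_{j<L} max(cos(2πj/L), 0) ≥ -4t (L/π + 1)`.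
The first inequality is the Lieb–Loss bathtub bound at Fermi level `0`
(`FreeKinetic.hubbardTorus_groundEnergyAt_ge`); the second is the Riemann-sum estimate of §A.
[cite: LiebLoss1993, §8, Theorem 8.2] -/
theorem hubbardChain_groundEnergyAt_zero_ge [NeZero L] (hL : 3 ≤ L) {t : ℝ} (ht : 0 ≤ t) {N : ℕ}
    (hN : N ≤ 2 * L) :
    -(4 * t) * (L / π + 1) ≤ groundEnergyAt (fermionTorusGraph 1 L) t 0 N := by
  have h := FreeKinetic.hubbardTorus_groundEnergyAt_ge (d := 1) (L := L) hL t (le_refl (0 : ℝ)) 0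
    (N := N) (by simpa using hN)
  rw [zero_mul, zero_add] at h
  have h1 : ∀ z : TorusSite 1 L, min (sdwBand t (cellCorner z) - 0) 0 =
      -(2 * t) * max (Real.cos (2 * π * ((z 0).val : ℕ) / L)) 0 := fun z => by
    rw [sub_zero, ← siteBand_neg_ofTorusSite_eq_sdwBand, siteBand_neg_ofTorusSite, level_eq]
    rw [show 2 * t * Real.cos (2 * π * ((z 0).val : ℕ) / L) =
      t * (2 * Real.cos (2 * π * ((z 0).val : ℕ) / L)) by ring]
    exact min_neg_level_eq ht _
  have hs : ∑ z : TorusSite 1 L, min (sdwBand t (cellCorner z) - 0) 0 =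
      -(2 * t) * ∑ j ∈ Finset.range L, max (Real.cos (2 * π * j / L)) 0 := by
    rw [Finset.sum_congr rfl fun z _ => h1 z, ← Finset.mul_sum]
    congr 1
    exact sum_torusSite_one_eq_sum_range L (fun j => max (Real.cos (2 * π * j / L)) 0)
  rw [hs] at h
  have hsum := sum_range_max_cos_le L (by omega)
  nlinarith [hsum, h, ht]

/-- `cos(2πj/L) ≥ 0` when `4j ≤ L`. [folklore] -/
private theorem cos_nonneg_of_four_mul_le {j L : ℕ} (hL : 0 < L) (h : 4 * j ≤ L) :
    0 ≤ Real.cos (2 * π * j / L) := by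
  have hLr : (0 : ℝ) < L := by exact_mod_cast hL
  have h' : (4 * j : ℝ) ≤ L := by exact_mod_cast h
  apply Real.cos_nonneg_of_neg_pi_div_two_le_of_le
  · have : 0 ≤ 2 * π * j / L := by positivity
    linarith [Real.pi_pos]
  · rw [div_le_iff₀ hLr]; nlinarith [Real.pi_pos]

/-- `cos(2πj/L) ≥ 0` when `3L ≤ 4j` and `j ≤ L`. [folklore] -/
private theorem cos_nonneg_of_three_mul_le {j L : ℕ} (hL : 0 < L) (h : 3 * L ≤ 4 * j) (hj : j ≤ L) :
    0 ≤ Real.cos (2 * π * j / L) := by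
  have hLr : (0 : ℝ) < L := by exact_mod_cast hL
  have h' : (3 * L : ℝ) ≤ 4 * j := by exact_mod_cast h
  have hj' : (j : ℝ) ≤ L := by exact_mod_cast hj
  rw [← Real.cos_sub_two_pi]
  apply Real.cos_nonneg_of_neg_pi_div_two_le_of_le
  · have : 3 * π / 2 ≤ 2 * π * j / L := by
      rw [le_div_iff₀ hLr]; nlinarith [Real.pi_pos]
    linarith
  · have : 2 * π * j / L ≤ 2 * π := by
      rw [div_le_iff₀ hLr]; nlinarith [Real.pi_pos]
    linarith [Real.pi_pos]

/-- `cos(2πj/L) ≤ 0` when `L ≤ 4j ≤ 3L`. [folklore] -/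
private theorem cos_nonpos_of_le_of_le {j L : ℕ} (hL : 0 < L) (h1 : L ≤ 4 * j) (h2 : 4 * j ≤ 3 * L) :
    Real.cos (2 * π * j / L) ≤ 0 := by
  have hLr : (0 : ℝ) < L := by exact_mod_cast hL
  have h1' : (L : ℝ) ≤ 4 * j := by exact_mod_cast h1
  have h2' : (4 * j : ℝ) ≤ 3 * L := by exact_mod_cast h2
  apply Real.cos_nonpos_of_pi_div_two_le_of_le
  · rw [le_div_iff₀ hLr]; nlinarith [Real.pi_pos]
  · rw [div_le_iff₀ hLr]; nlinarith [Real.pi_pos]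

/-- **Exact free-fermion ground-state energy of the half-filled even ring.** For `L = 2n ≥ 4`,
`t ≥ 0`, `U = 0` and `N = L` electrons (all `S^z`),

  `E_L(L) = -4t · Σ_{j ∈ [0,⌈n/2⌉) ∪ [2n-⌊n/2⌋, 2n)} cos(2πj/L)`,

i.e. `-4t` times the sum of `cos k` over the momenta `k = 2πj/L` with `cos k > 0` (together with the
zero mode `k = 3π/2` when `4 ∣ L`), each filled with both spins: this Fermi sea (`⌈n/2⌉ + ⌊n/2⌋ = n`
momenta per spin) satisfies the Fermi-level-`0` hypotheses of
`FreeFermionTorus.hubbardTorus_groundEnergyAt_zero_eq_two_mul` (bathtub lower bound = Slater upper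
bound). It is the `U = 0` case of the Lieb–Wu ring energy: Lieb–Wu (2003) §4,
`E = -2N_a ∫_{-Q}^{Q} ρ(k) cos k dk`, with §6 Remark (A), `ρ₀ = 1/π` on `|k| ≤ π/2` at `U = 0` ("what is
expected for an ideal Fermi gas"). (`t ≥ 0`; on even rings the sign of `t` is a gauge.)
[cite: LiebWuPhysicaA2003, §4 and §6 Remark (A)][cite: LiebLoss1993, §8, Theorem 8.2] -/
theorem hubbardChain_groundEnergyAt_zero_eq (n : ℕ) (hn : 2 ≤ n) {t : ℝ} (ht : 0 ≤ t) :
    groundEnergyAt (fermionTorusGraph 1 (2 * n)) t 0 (2 * n) =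
      -(4 * t) * ∑ j ∈ Finset.range ((n + 1) / 2) ∪ Finset.Ico (2 * n - n / 2) (2 * n),
        Real.cos (2 * π * j / (2 * n : ℕ)) := by
  classical
  haveI : NeZero (2 * n) := ⟨by omega⟩
  set L : ℕ := 2 * n with hLdef
  set A : Finset ℕ := Finset.range ((n + 1) / 2) ∪ Finset.Ico (L - n / 2) L with hA
  have hLpos : 0 < L := by omega
  have hAL : ∀ j ∈ A, j < L := by
    intro j hj
    rcases Finset.mem_union.1 hj with h | h
    · have := Finset.mem_range.1 h; omega
    · exact (Finset.mem_Ico.1 h).2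
  have hcardA : A.card = n := by
    rw [hA, Finset.card_union_of_disjoint, Finset.card_range, Nat.card_Ico]
    · omega
    · exact Finset.disjoint_left.2 fun j h1 h2 => by
        have := Finset.mem_range.1 h1; have := (Finset.mem_Ico.1 h2).1; omega
  -- the Fermi sea: the momenta with representatives in `A`, as a subset of `(ℤ/Lℤ)^1`
  set S : Finset (TorusSite 1 L) := A.image (fun j : ℕ => fun _ : Fin 1 => (j : ZMod L)) with hS
  have hinj : Set.InjOn (fun j : ℕ => fun _ : Fin 1 => (j : ZMod L)) ↑A := by
    intro j hj j' hj' h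
    have h0 := congrArg ZMod.val (congrFun h 0)
    rwa [ZMod.val_cast_of_lt (hAL j (Finset.mem_coe.1 hj)),
      ZMod.val_cast_of_lt (hAL j' (Finset.mem_coe.1 hj'))] at h0
  have hmem : ∀ k : TorusSite 1 L, k ∈ S ↔ (k 0).val ∈ A := fun k => by
    constructor
    · intro h
      obtain ⟨j, hj, rfl⟩ := Finset.mem_image.1 h
      show ((j : ZMod L)).val ∈ A
      rwa [ZMod.val_cast_of_lt (hAL j hj)]
    · intro h
      refine Finset.mem_image.2 ⟨(k 0).val, h, funext fun i => ?_⟩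
      rw [Fin.fin_one_eq_zero i]
      exact ZMod.natCast_zmod_val (k 0)
  have hcardS : S.card = n := by rw [hS, Finset.card_image_of_injOn hinj, hcardA]
  -- the Fermi-sea conditions at level `0`
  have hsea : ∀ k ∈ S, -(t * (2 * ∑ i, Real.cos (latticeMomentum L k i))) ≤ 0 := by
    intro k hk
    have hj := (hmem k).1 hk
    rw [level_eq, neg_nonpos]
    refine mul_nonneg (by positivity) ?_
    rcases Finset.mem_union.1 hj with h | h
    · exact cos_nonneg_of_four_mul_le hLpos (by have := Finset.mem_range.1 h; omega)
    · have h' := Finset.mem_Ico.1 h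
      exact cos_nonneg_of_three_mul_le hLpos (by omega) (by omega)
  have hsea' : ∀ k ∉ S, (0 : ℝ) ≤ -(t * (2 * ∑ i, Real.cos (latticeMomentum L k i))) := by
    intro k hk
    have hj : (k 0).val ∉ A := fun h => hk ((hmem k).2 h)
    have hjL : (k 0).val < L := ZMod.val_lt _
    have h1 : ¬ (k 0).val < (n + 1) / 2 := fun h =>
      hj (Finset.mem_union.2 (Or.inl (Finset.mem_range.2 h)))
    have h2 : ¬ (L - n / 2 ≤ (k 0).val) := fun h =>
      hj (Finset.mem_union.2 (Or.inr (Finset.mem_Ico.2 ⟨h, hjL⟩)))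
    rw [level_eq]
    exact neg_nonneg.2 (mul_nonpos_of_nonneg_of_nonpos (by positivity)
      (cos_nonpos_of_le_of_le hLpos (by omega) (by omega)))
  have hE := FreeFermionTorus.hubbardTorus_groundEnergyAt_zero_eq_two_mul (d := 1) (L := L)
    (by omega) t 0 S hsea hsea'
  rw [hcardS, ← hLdef] at hE
  rw [hE, hS, Finset.sum_image hinj]
  have hterm : ∀ j ∈ A,
      t * (2 * ∑ i, Real.cos (latticeMomentum L ((fun j : ℕ => fun _ : Fin 1 => (j : ZMod L)) j) i)) =
        2 * t * Real.cos (2 * π * j / L) := fun j hj => by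
    rw [level_eq]
    simp only [ZMod.val_cast_of_lt (hAL j hj)]
  rw [Finset.sum_congr rfl hterm, ← Finset.mul_sum]
  ring

/-- The Fermi-sea sum of the ring `L = 4m` is at least its Riemann integral minus one:
`Σ_{j<m} cos(πj/2m) + Σ_{3m ≤ j < 4m} cos(πj/2m) = 2 Σ_{j<m} cos(πj/2m) - 1 ≥ 4m/π - 1`
(`cos(πu/2m)` is antitone on `[0, m]`, so the left Riemann sum dominates `∫₀^m = 2m/π`). [folklore] -/
private theorem fermiSum_four_mul_ge (m : ℕ) (hm : 1 ≤ m) :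
    (4 * m : ℕ) / π - 1 ≤ ∑ j ∈ Finset.range m ∪ Finset.Ico (3 * m) (4 * m),
      Real.cos (2 * π * j / (4 * m : ℕ)) := by
  have hmpos : (0 : ℝ) < m := by exact_mod_cast hm
  set θ : ℝ := 2 * π / (4 * m : ℕ) with hθdef
  have hθ : 0 < θ := by rw [hθdef]; positivity
  have hθm : θ * m = π / 2 := by rw [hθdef]; push_cast; field_simp; ring
  have h2θ : 2 * (1 / θ) - 1 = (4 * m : ℕ) / π - 1 := by rw [hθdef]; push_cast; field_simp
  have hsummand : ∀ j : ℕ, Real.cos (2 * π * j / (4 * m : ℕ)) = Real.cos (θ * j) := fun j => by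
    rw [hθdef]; ring_nf
  simp_rw [hsummand]
  have hdisj : Disjoint (Finset.range m) (Finset.Ico (3 * m) (4 * m)) :=
    Finset.disjoint_left.2 fun j h1 h2 => by
      have := Finset.mem_range.1 h1; have := (Finset.mem_Ico.1 h2).1; omega
  rw [Finset.sum_union hdisj]
  -- the first block dominates `∫₀^m cos(θu) du = 1/θ`
  have hanti : AntitoneOn (fun u : ℝ => Real.cos (θ * u)) (Icc (0 : ℝ) (0 + m)) := by
    intro x hx y hy hxy
    simp only [zero_add] at hx hy
    exact Real.cos_le_cos_of_nonneg_of_le_pi (by nlinarith [hx.1, hθ.le])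
      (by nlinarith [hy.2, hθ.le, hθm, Real.pi_pos]) (mul_le_mul_of_nonneg_left hxy hθ.le)
  have hint : ∫ u in (0 : ℝ)..(0 + m), Real.cos (θ * u) = 1 / θ := by
    have h := intervalIntegral.integral_comp_mul_left (fun x => Real.cos x) hθ.ne' (a := 0) (b := (m : ℝ))
    simp only [mul_zero] at h
    rw [zero_add, h, hθm, integral_cos, Real.sin_pi_div_two, Real.sin_zero, smul_eq_mul]
    ring
  have hA : 1 / θ ≤ ∑ j ∈ Finset.range m, Real.cos (θ * j) := by
    have h := hanti.integral_le_sum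
    beta_reduce at h
    rw [hint] at h
    simpa using h
  -- the second block is the first minus `cos 0 = 1` plus `cos(θm) = 0` (reflection `j ↦ 4m - j`)
  have hB : ∑ j ∈ Finset.Ico (3 * m) (4 * m), Real.cos (θ * j) =
      ∑ j ∈ Finset.range m, Real.cos (θ * j) - 1 := by
    have hrefl := Finset.sum_Ico_reflect (fun j : ℕ => Real.cos (θ * j)) 1 (m := m + 1) (n := 4 * m)
      (by omega)
    beta_reduce at hrefl
    rw [show 4 * m + 1 - (m + 1) = 3 * m by omega, show 4 * m + 1 - 1 = 4 * m by omega] at hrefl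
    rw [← hrefl]
    have hper : ∀ j ∈ Finset.Ico 1 (m + 1), Real.cos (θ * ((4 * m - j : ℕ) : ℝ)) = Real.cos (θ * j) := by
      intro j hj
      have hj4 : j ≤ 4 * m := by have := (Finset.mem_Ico.1 hj).2; omega
      rw [Nat.cast_sub hj4, mul_sub]
      have h4 : θ * ((4 * m : ℕ) : ℝ) = 2 * π := by rw [hθdef]; field_simp
      rw [h4, show 2 * π - θ * (j : ℝ) = -(θ * (j : ℝ) - 2 * π) by ring, Real.cos_neg,
        Real.cos_sub_two_pi]
    have hcm : Real.cos (θ * (m : ℕ)) = 0 := by rw [hθm, Real.cos_pi_div_two]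
    have hc0 : Real.cos (θ * (0 : ℕ)) = 1 := by simp
    rw [Finset.sum_congr rfl hper, Finset.sum_Ico_succ_top hm, hcm, add_zero, Finset.range_eq_Ico,
      Finset.sum_eq_sum_Ico_succ_bot hm, hc0]
    ring
  rw [hB, ← h2θ]
  linarith

/-- **Free-fermion upper bound on the rings `L = 4m`** (`m ≥ 1`, `t ≥ 0`, `U = 0`, half filling):
`E_{4m}(4m) ≤ -4t (4m/π - 1)` — the exact Fermi-sea energy
(`hubbardChain_groundEnergyAt_zero_eq`) is `-4t (2 Σ_{j<m} cos(πj/2m) - 1)` and the Riemann sum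
dominates its integral. Together with `hubbardChain_groundEnergyAt_zero_ge`:
`|E_{4m}(4m) + 16tm/π| ≤ 4t`. [cite: LiebWuPhysicaA2003, §4 and §6 Remark (A)] -/
theorem hubbardChain_groundEnergyAt_zero_le (m : ℕ) (hm : 1 ≤ m) {t : ℝ} (ht : 0 ≤ t) :
    groundEnergyAt (fermionTorusGraph 1 (4 * m)) t 0 (4 * m) ≤ -(4 * t) * ((4 * m : ℕ) / π - 1) := by
  have hE := hubbardChain_groundEnergyAt_zero_eq (2 * m) (by omega) ht
  rw [show 2 * (2 * m) = 4 * m by ring] at hE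
  rw [show (2 * m + 1) / 2 = m by omega, show 4 * m - 2 * m / 2 = 3 * m by omega] at hE
  rw [hE]
  exact mul_le_mul_of_nonpos_left (fermiSum_four_mul_ge m hm) (by linarith)

/-! ### §C The thermodynamic limit: `e(t, 0) = -4t/π` -/

/-- **The ground-state energy density of the half-filled Hubbard chain at `U = 0` is the
free-fermion value `e(t, 0) = -4t/π`** (`t ≥ 0`): the tree's thermodynamic limit
`ThermodynamicLimit.hubbardChainEnergyDensity t 0 = lim_L E_L(L)/L` equals `-4t/π`. Upper bound: the
rings `L = 4m` (`hubbardChain_groundEnergyAt_zero_le`) through the subadditive estimate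
`hubbardChainEnergyDensity_le_of_le` (`e ≤ E_L(L)/L + 8|t|/L`); lower bound: the bathtub bound
`hubbardChain_groundEnergyAt_zero_ge` on every ring through `hubbardChainEnergyDensity_ge_of_forall_ge`.
This is the `U = 0` endpoint of the Lieb–Wu energy: Lieb–Wu (2003) §4, `E = -2N_a∫_{-Q}^{Q} ρ(k) cos k dk`,
with §6 Remark (A), `ρ₀(k) = 1/π` for `|k| ≤ π/2` at `U = 0`, i.e. `E/N_a = -(2/π)·2 = -4/π` at `t = 1`
(outside the scope `U > 0` of the tree's named fact `lieb_wu`).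
[cite: LiebWuPhysicaA2003, §4 and §6 Remark (A)] -/
theorem hubbardChainEnergyDensity_zero {t : ℝ} (ht : 0 ≤ t) :
    hubbardChainEnergyDensity t 0 = -(4 * t) / π := by
  refine le_antisymm ?_ ?_
  · -- upper bound from the rings `L = 4(m+1)`
    refine le_of_forall_pos_le_add fun ε hε => ?_
    obtain ⟨m, hm⟩ := exists_nat_gt (3 * t / ε)
    have hM : (0 : ℝ) < ((m + 1 : ℕ) : ℝ) := by positivity
    have hE := hubbardChain_groundEnergyAt_zero_le (m + 1) (by omega) ht
    have h := hubbardChainEnergyDensity_le_of_le t (le_refl (0 : ℝ)) (L := 4 * (m + 1)) (by omega) hE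
    rw [abs_of_nonneg ht] at h
    have hcalc : -(4 * t) * (((4 * (m + 1) : ℕ) : ℝ) / π - 1) / ((4 * (m + 1) : ℕ) : ℝ) +
        8 * t / ((4 * (m + 1) : ℕ) : ℝ) = -(4 * t) / π + 3 * t / ((m + 1 : ℕ) : ℝ) := by
      push_cast; field_simp; ring
    rw [hcalc] at h
    have h3 : 3 * t / ((m + 1 : ℕ) : ℝ) ≤ ε := by
      rw [div_le_iff₀ hM]
      have h' : 3 * t / ε < m := hm
      rw [div_lt_iff₀ hε] at h'
      have hm1 : (m : ℝ) ≤ ((m + 1 : ℕ) : ℝ) := by push_cast; linarith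
      nlinarith [h', hm1, hε.le]
    linarith
  · -- lower bound on every ring `L ≥ L₀`
    refine le_of_forall_pos_le_add fun ε hε => ?_
    obtain ⟨L₀, hL₀⟩ := exists_nat_gt (4 * t / ε)
    have key : ∀ L : ℕ, L₀ + 3 ≤ L → Even L →
        -(4 * t) / π - ε ≤ groundEnergyAt (fermionTorusGraph 1 L) t 0 L / (L : ℝ) := by
      intro L hL _
      haveI : NeZero L := ⟨by omega⟩
      have hLpos : (0 : ℝ) < L := by exact_mod_cast (by omega : 0 < L)
      have hE := hubbardChain_groundEnergyAt_zero_ge (L := L) (by omega) ht (N := L) (by omega)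
      rw [le_div_iff₀ hLpos]
      have hεL : 4 * t ≤ ε * L := by
        have h1 : 4 * t / ε < L₀ := hL₀
        rw [div_lt_iff₀ hε] at h1
        have h2 : (L₀ : ℝ) ≤ L := by exact_mod_cast (by omega : L₀ ≤ L)
        nlinarith [h1, h2, hε.le]
      have hid : (-(4 * t) / π - ε) * L = -(4 * t) * (L / π + 1) + (4 * t - ε * L) := by ring
      rw [hid]
      linarith
    have h := hubbardChainEnergyDensity_ge_of_forall_ge t (le_refl (0 : ℝ)) (L₀ + 3) key
    linarith


/-! ### §D Kernel-exact free-fermion energies of the small half-filled rings `L = 4, 6, 8, 10, 12` -/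

/-- `hubbardChain_groundEnergyAt_zero_eq` with the ring length as a free variable `L = 2n` (the form
that instantiates at numerals). [cite: LiebWuPhysicaA2003, §4 and §6 Remark (A)] -/
theorem hubbardChain_groundEnergyAt_zero_eq_of_eq (n : ℕ) (hn : 2 ≤ n) (hL : L = 2 * n) {t : ℝ}
    (ht : 0 ≤ t) :
    groundEnergyAt (fermionTorusGraph 1 L) t 0 L =
      -(4 * t) * ∑ j ∈ Finset.range ((n + 1) / 2) ∪ Finset.Ico (L - n / 2) L,
        Real.cos (2 * π * j / L) := by
  subst hL
  exact hubbardChain_groundEnergyAt_zero_eq n hn ht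

/-- `cos(2π a / L)` at an angle written as `q·π` with `q` rational: normal form helper. [folklore] -/
private theorem cos_angle_eq {a L : ℕ} {x : ℝ} (h : 2 * π * (a : ℝ) / (L : ℝ) = x) :
    Real.cos (2 * π * (a : ℝ) / (L : ℝ)) = Real.cos x := by rw [h]

/-- `cos(3π/2) = 0`. [folklore] -/
private theorem cos_three_pi_div_two : Real.cos (3 * π / 2) = 0 := by
  rw [show (3 * π / 2 : ℝ) = π / 2 + π by ring, Real.cos_add_pi, Real.cos_pi_div_two, neg_zero]

/-- `cos(2π - x) = cos x`. [folklore] -/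
private theorem cos_two_pi_sub' (x : ℝ) : Real.cos (2 * π - x) = Real.cos x := by
  rw [show 2 * π - x = -(x - 2 * π) by ring, Real.cos_neg, Real.cos_sub_two_pi]

/-- `cos(2π/5) = (√5 - 1)/4` (double angle of `cos(π/5) = (1 + √5)/4`). [folklore] -/
private theorem cos_two_pi_div_five : Real.cos (2 * π / 5) = (Real.sqrt 5 - 1) / 4 := by
  rw [show (2 * π / 5 : ℝ) = 2 * (π / 5) by ring, Real.cos_two_mul, Real.cos_pi_div_five]
  have h5 : Real.sqrt 5 ^ 2 = 5 := Real.sq_sqrt (by norm_num)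
  nlinarith [h5]

/-- **`L = 4`**: `E_4(4)(t, 0) = -4t` (levels `-2t, 0, 0, 2t`). [cite: LiebWuPhysicaA2003, §4 and §6 Remark (A)] -/
theorem hubbardChain4_groundEnergyAt_zero {t : ℝ} (ht : 0 ≤ t) :
    groundEnergyAt (fermionTorusGraph 1 4) t 0 4 = -(4 * t) := by
  rw [hubbardChain_groundEnergyAt_zero_eq_of_eq 2 le_rfl (by norm_num) ht]
  have hA : Finset.range ((2 + 1) / 2) ∪ Finset.Ico (4 - 2 / 2) 4 = {0, 3} := by decide
  rw [hA, Finset.sum_insert (by decide), Finset.sum_singleton]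
  rw [cos_angle_eq (x := 0) (by push_cast; ring), cos_angle_eq (x := 3 * π / 2) (by push_cast; ring),
    Real.cos_zero, cos_three_pi_div_two]
  ring

/-- **`L = 6`**: `E_6(6)(t, 0) = -8t`. [cite: LiebWuPhysicaA2003, §4 and §6 Remark (A)] -/
theorem hubbardChain6_groundEnergyAt_zero {t : ℝ} (ht : 0 ≤ t) :
    groundEnergyAt (fermionTorusGraph 1 6) t 0 6 = -(8 * t) := by
  rw [hubbardChain_groundEnergyAt_zero_eq_of_eq 3 (by norm_num) (by norm_num) ht]
  have hA : Finset.range ((3 + 1) / 2) ∪ Finset.Ico (6 - 3 / 2) 6 = {0, 1, 5} := by decide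
  rw [hA, Finset.sum_insert (by decide), Finset.sum_insert (by decide), Finset.sum_singleton]
  rw [cos_angle_eq (a := 0) (x := 0) (by push_cast; ring),
    cos_angle_eq (a := 1) (x := π / 3) (by push_cast; ring),
    cos_angle_eq (a := 5) (x := 2 * π - π / 3) (by push_cast; ring),
    Real.cos_zero, cos_two_pi_sub', Real.cos_pi_div_three]
  ring

/-- **`L = 8`**: `E_8(8)(t, 0) = -4t(1 + √2)`. [cite: LiebWuPhysicaA2003, §4 and §6 Remark (A)] -/
theorem hubbardChain8_groundEnergyAt_zero {t : ℝ} (ht : 0 ≤ t) :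
    groundEnergyAt (fermionTorusGraph 1 8) t 0 8 = -(4 * t) * (1 + Real.sqrt 2) := by
  rw [hubbardChain_groundEnergyAt_zero_eq_of_eq 4 (by norm_num) (by norm_num) ht]
  have hA : Finset.range ((4 + 1) / 2) ∪ Finset.Ico (8 - 4 / 2) 8 = {0, 1, 6, 7} := by decide
  rw [hA, Finset.sum_insert (by decide), Finset.sum_insert (by decide), Finset.sum_insert (by decide),
    Finset.sum_singleton]
  rw [cos_angle_eq (a := 0) (x := 0) (by push_cast; ring),
    cos_angle_eq (a := 1) (x := π / 4) (by push_cast; ring),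
    cos_angle_eq (a := 6) (x := 3 * π / 2) (by push_cast; ring),
    cos_angle_eq (a := 7) (x := 2 * π - π / 4) (by push_cast; ring),
    Real.cos_zero, cos_three_pi_div_two, cos_two_pi_sub', Real.cos_pi_div_four]
  ring

/-- **`L = 10`**: `E_10(10)(t, 0) = -4t(1 + √5)` (the Lieb–Wu ring `N_a = 2 × odd` nearest the
bundle's rows). [cite: LiebWuPhysicaA2003, §4 and §6 Remark (A)] -/
theorem hubbardChain10_groundEnergyAt_zero {t : ℝ} (ht : 0 ≤ t) :
    groundEnergyAt (fermionTorusGraph 1 10) t 0 10 = -(4 * t) * (1 + Real.sqrt 5) := by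
  rw [hubbardChain_groundEnergyAt_zero_eq_of_eq 5 (by norm_num) (by norm_num) ht]
  have hA : Finset.range ((5 + 1) / 2) ∪ Finset.Ico (10 - 5 / 2) 10 = {0, 1, 2, 8, 9} := by decide
  rw [hA, Finset.sum_insert (by decide), Finset.sum_insert (by decide), Finset.sum_insert (by decide),
    Finset.sum_insert (by decide), Finset.sum_singleton]
  rw [cos_angle_eq (a := 0) (x := 0) (by push_cast; ring),
    cos_angle_eq (a := 1) (x := π / 5) (by push_cast; ring),
    cos_angle_eq (a := 2) (x := 2 * π / 5) (by push_cast; ring),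
    cos_angle_eq (a := 8) (x := 2 * π - 2 * π / 5) (by push_cast; ring),
    cos_angle_eq (a := 9) (x := 2 * π - π / 5) (by push_cast; ring),
    Real.cos_zero, cos_two_pi_sub', cos_two_pi_sub', Real.cos_pi_div_five, cos_two_pi_div_five]
  ring

/-- **`L = 12`**: `E_12(12)(t, 0) = -4t(2 + √3)`. [cite: LiebWuPhysicaA2003, §4 and §6 Remark (A)] -/
theorem hubbardChain12_groundEnergyAt_zero {t : ℝ} (ht : 0 ≤ t) :
    groundEnergyAt (fermionTorusGraph 1 12) t 0 12 = -(4 * t) * (2 + Real.sqrt 3) := by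
  rw [hubbardChain_groundEnergyAt_zero_eq_of_eq 6 (by norm_num) (by norm_num) ht]
  have hA : Finset.range ((6 + 1) / 2) ∪ Finset.Ico (12 - 6 / 2) 12 = {0, 1, 2, 9, 10, 11} := by decide
  rw [hA, Finset.sum_insert (by decide), Finset.sum_insert (by decide), Finset.sum_insert (by decide),
    Finset.sum_insert (by decide), Finset.sum_insert (by decide), Finset.sum_singleton]
  rw [cos_angle_eq (a := 0) (x := 0) (by push_cast; ring),
    cos_angle_eq (a := 1) (x := π / 6) (by push_cast; ring),
    cos_angle_eq (a := 2) (x := π / 3) (by push_cast; ring),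
    cos_angle_eq (a := 9) (x := 3 * π / 2) (by push_cast; ring),
    cos_angle_eq (a := 10) (x := 2 * π - π / 3) (by push_cast; ring),
    cos_angle_eq (a := 11) (x := 2 * π - π / 6) (by push_cast; ring),
    Real.cos_zero, cos_three_pi_div_two, cos_two_pi_sub', cos_two_pi_sub', Real.cos_pi_div_three,
    Real.cos_pi_div_six]
  ring


/-- `cos(3π/8) = sin(π/8) = √(2 - √2)/2`. [folklore] -/
private theorem cos_three_pi_div_eight : Real.cos (3 * π / 8) = Real.sqrt (2 - Real.sqrt 2) / 2 := by
  rw [show (3 * π / 8 : ℝ) = π / 2 - π / 8 by ring, Real.cos_pi_div_two_sub, Real.sin_pi_div_eight]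

/-- **`L = 16`**: `E_16(16)(t, 0) = -4t(1 + √2 + √(2+√2) + √(2-√2))` (the largest ring of the bundle's
exact-diagonalisation rows). [cite: LiebWuPhysicaA2003, §4 and §6 Remark (A)] -/
theorem hubbardChain16_groundEnergyAt_zero {t : ℝ} (ht : 0 ≤ t) :
    groundEnergyAt (fermionTorusGraph 1 16) t 0 16 =
      -(4 * t) * (1 + Real.sqrt 2 + Real.sqrt (2 + Real.sqrt 2) + Real.sqrt (2 - Real.sqrt 2)) := by
  rw [hubbardChain_groundEnergyAt_zero_eq_of_eq 8 (by norm_num) (by norm_num) ht]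
  have hA : Finset.range ((8 + 1) / 2) ∪ Finset.Ico (16 - 8 / 2) 16 = {0, 1, 2, 3, 12, 13, 14, 15} := by
    decide
  rw [hA, Finset.sum_insert (by decide), Finset.sum_insert (by decide), Finset.sum_insert (by decide),
    Finset.sum_insert (by decide), Finset.sum_insert (by decide), Finset.sum_insert (by decide),
    Finset.sum_insert (by decide), Finset.sum_singleton]
  rw [cos_angle_eq (a := 0) (x := 0) (by push_cast; ring),
    cos_angle_eq (a := 1) (x := π / 8) (by push_cast; ring),
    cos_angle_eq (a := 2) (x := π / 4) (by push_cast; ring),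
    cos_angle_eq (a := 3) (x := 3 * π / 8) (by push_cast; ring),
    cos_angle_eq (a := 12) (x := 3 * π / 2) (by push_cast; ring),
    cos_angle_eq (a := 13) (x := 2 * π - 3 * π / 8) (by push_cast; ring),
    cos_angle_eq (a := 14) (x := 2 * π - π / 4) (by push_cast; ring),
    cos_angle_eq (a := 15) (x := 2 * π - π / 8) (by push_cast; ring),
    Real.cos_zero, cos_three_pi_div_two, cos_two_pi_sub', cos_two_pi_sub', cos_two_pi_sub',
    Real.cos_pi_div_eight, Real.cos_pi_div_four, cos_three_pi_div_eight]
  ring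

/-- **`e(1, 0) = -4/π`**: the `t = 1` normalisation of the bundle's chain rows.
[cite: LiebWuPhysicaA2003, §4 and §6 Remark (A)] -/
theorem hubbardChainEnergyDensity_one_zero : hubbardChainEnergyDensity 1 0 = -4 / π := by
  rw [hubbardChainEnergyDensity_zero zero_le_one]; ring


/-! ### §E Quarter filling at `U = 0`: `e(t, 0; n = 1/2) = -2√2·t/π`

The same three steps with the Fermi level `μ = -√2 t = ε(π/4)`: a bathtub lower bound on every ring
with the Riemann estimate for the threshold `cos k - √2/2`, the exact Fermi-sea energy of the rings
`L = 8m` with `N = 4m` electrons, and the limit along `hubbardChainEnergyDensityAt t 0 1 2`. -/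

/-- The positive part `∫₀^π max(cos x - c, 0) dx` is monotone in the upper limit: for `0 < θ`, `0 ≤ a`,
`θa ≤ π`, `∫₀^a max(cos(θu) - c, 0) du ≤ θ⁻¹ ∫₀^π max(cos x - c, 0) dx`. [folklore] -/
private theorem integral_max_cos_sub_mul_le (c : ℝ) {θ : ℝ} (hθ : 0 < θ) {a : ℝ} (ha0 : 0 ≤ a)
    (ha : θ * a ≤ π) :
    ∫ u in (0:ℝ)..a, max (Real.cos (θ * u) - c) 0 ≤
      (∫ x in (0:ℝ)..π, max (Real.cos x - c) 0) / θ := by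
  have hcont : Continuous fun x : ℝ => max (Real.cos x - c) 0 :=
    (Real.continuous_cos.sub continuous_const).max continuous_const
  have hsub : ∫ u in (0:ℝ)..a, max (Real.cos (θ * u) - c) 0 =
      θ⁻¹ * ∫ x in (0:ℝ)..(θ * a), max (Real.cos x - c) 0 := by
    have h := intervalIntegral.integral_comp_mul_left (fun x => max (Real.cos x - c) 0) (hθ.ne')
      (a := 0) (b := a)
    simpa using h
  have hmono : ∫ x in (0:ℝ)..(θ * a), max (Real.cos x - c) 0 ≤ ∫ x in (0:ℝ)..π, max (Real.cos x - c) 0 := by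
    refine intervalIntegral.integral_mono_interval le_rfl (by positivity) ha ?_ ?_
    · exact Filter.Eventually.of_forall fun x => le_max_right _ _
    · exact hcont.intervalIntegrable _ _
  rw [hsub, div_eq_inv_mul]
  exact mul_le_mul_of_nonneg_left hmono (inv_nonneg.2 hθ.le)

/-- Unit-step Riemann sum of the antitone `u ↦ max(cos(θu) - c, 0)` on `[0, J]`, `Jθ ≤ π`. [folklore] -/
private theorem sum_max_cos_sub_succ_le (c : ℝ) {θ : ℝ} (hθ : 0 < θ) (J : ℕ) (hJ : θ * J ≤ π) :
    ∑ i ∈ Finset.range J, max (Real.cos (θ * ((i : ℕ) + 1 : ℕ)) - c) 0 ≤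
      (∫ x in (0:ℝ)..π, max (Real.cos x - c) 0) / θ := by
  have hanti : AntitoneOn (fun u : ℝ => max (Real.cos (θ * u) - c) 0) (Icc (0:ℝ) (0 + J)) := by
    intro x hx y hy hxy
    simp only [zero_add] at hx hy
    refine max_le_max ?_ le_rfl
    have := Real.cos_le_cos_of_nonneg_of_le_pi (by nlinarith [hx.1, hθ.le])
      (le_trans (mul_le_mul_of_nonneg_left hy.2 hθ.le) hJ) (mul_le_mul_of_nonneg_left hxy hθ.le)
    linarith
  have h := hanti.sum_le_integral
  simp only [zero_add] at h
  calc ∑ i ∈ Finset.range J, max (Real.cos (θ * ((i : ℕ) + 1 : ℕ)) - c) 0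
      = ∑ i ∈ Finset.range J, max (Real.cos (θ * ((i : ℝ) + 1)) - c) 0 := by
        refine Finset.sum_congr rfl fun i _ => ?_; push_cast; ring_nf
    _ ≤ ∫ u in (0:ℝ)..(J:ℝ), max (Real.cos (θ * u) - c) 0 := by simpa using h
    _ ≤ _ := integral_max_cos_sub_mul_le c hθ (Nat.cast_nonneg J) hJ

/-- **`Σ_{j<L} max(cos(2πj/L) - c, 0) ≤ (L/π)·∫₀^π max(cos x - c, 0) dx + (1 - c)`** (`L ≥ 1`,
`c ≤ 1`): the Riemann-sum estimate of §A at a general Fermi threshold. [folklore] -/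
private theorem sum_range_max_cos_sub_le (c : ℝ) (hc : c ≤ 1) (L : ℕ) (hL : 1 ≤ L) :
    ∑ j ∈ Finset.range L, max (Real.cos (2 * π * j / L) - c) 0 ≤
      L / π * (∫ x in (0:ℝ)..π, max (Real.cos x - c) 0) + (1 - c) := by
  have hLpos : (0:ℝ) < L := by exact_mod_cast hL
  set I : ℝ := ∫ x in (0:ℝ)..π, max (Real.cos x - c) 0 with hIdef
  set θ : ℝ := 2 * π / L with hθdef
  have hθ : 0 < θ := by positivity
  have hθL : θ * L = 2 * π := by rw [hθdef]; field_simp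
  have hinvθ : I / θ = I * L / (2 * π) := by rw [hθdef]; field_simp
  have hsummand : ∀ j : ℕ, Real.cos (2 * π * j / L) = Real.cos (θ * j) := fun j => by
    rw [hθdef]; ring_nf
  simp_rw [hsummand]
  set J : ℕ := L / 2 with hJdef
  have hJL : J + 1 ≤ L := by omega
  obtain ⟨M, hM⟩ : ∃ M, L = (J + 1) + M := ⟨L - (J + 1), by omega⟩
  have hJθ : θ * J ≤ π := by
    have h2J : (2 * J : ℕ) ≤ L := by omega
    have : θ * J = π * ((2 * J : ℕ) / (L : ℝ)) := by rw [hθdef]; push_cast; field_simp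
    rw [this]
    have hle : ((2 * J : ℕ) : ℝ) / L ≤ 1 := by
      rw [div_le_one hLpos]; exact_mod_cast h2J
    nlinarith [Real.pi_pos]
  have hMθ : θ * M ≤ π := by
    have h2M : (2 * M : ℕ) ≤ L := by omega
    have : θ * M = π * ((2 * M : ℕ) / (L : ℝ)) := by rw [hθdef]; push_cast; field_simp
    rw [this]
    have hle : ((2 * M : ℕ) : ℝ) / L ≤ 1 := by
      rw [div_le_one hLpos]; exact_mod_cast h2M
    nlinarith [Real.pi_pos]
  have hsplit : ∑ j ∈ Finset.range L, max (Real.cos (θ * j) - c) 0 =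
      ∑ j ∈ Finset.range (J + 1), max (Real.cos (θ * j) - c) 0 +
        ∑ i ∈ Finset.range M, max (Real.cos (θ * ((J + 1 + i : ℕ) : ℝ)) - c) 0 := by
    rw [hM, Finset.sum_range_add]
  have hA : ∑ j ∈ Finset.range (J + 1), max (Real.cos (θ * j) - c) 0 ≤ (1 - c) + I / θ := by
    rw [Finset.sum_range_succ']
    have h0 : max (Real.cos (θ * ((0:ℕ) : ℝ)) - c) 0 = 1 - c := by
      simp only [Nat.cast_zero, mul_zero, Real.cos_zero]; exact max_eq_left (by linarith)
    rw [h0]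
    have h1 := sum_max_cos_sub_succ_le c hθ J hJθ
    have : ∑ i ∈ Finset.range J, max (Real.cos (θ * ((i + 1 : ℕ) : ℝ)) - c) 0 ≤ I / θ := by
      simpa using h1
    linarith
  have hB : ∑ i ∈ Finset.range M, max (Real.cos (θ * ((J + 1 + i : ℕ) : ℝ)) - c) 0 ≤ I / θ := by
    have hrefl : ∑ i ∈ Finset.range M, max (Real.cos (θ * ((J + 1 + i : ℕ) : ℝ)) - c) 0 =
        ∑ i ∈ Finset.range M, max (Real.cos (θ * ((i : ℕ) + 1 : ℕ)) - c) 0 := by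
      rw [← Finset.sum_range_reflect (fun i => max (Real.cos (θ * ((i : ℕ) + 1 : ℕ)) - c) 0) M]
      refine Finset.sum_congr rfl fun i hi => ?_
      have hiM : i < M := Finset.mem_range.mp hi
      have hid : ((J + 1 + i : ℕ) : ℝ) = L - ((M - 1 - i : ℕ) + 1 : ℕ) := by
        have : (M - 1 - i : ℕ) + 1 + (J + 1 + i) = L := by omega
        have h' : (((M - 1 - i : ℕ) + 1 : ℕ) : ℝ) + ((J + 1 + i : ℕ) : ℝ) = L := by exact_mod_cast this
        linarith
      rw [hid, mul_sub, hθL,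
        show 2 * π - θ * (((M - 1 - i : ℕ) + 1 : ℕ) : ℝ) = -(θ * (((M - 1 - i : ℕ) + 1 : ℕ) : ℝ) - 2 * π) by ring,
        Real.cos_neg, Real.cos_sub_two_pi]
    rw [hrefl]
    simpa [hIdef] using sum_max_cos_sub_succ_le c hθ M hMθ
  have htot : ((1 - c) + I / θ) + I / θ = L / π * I + (1 - c) := by rw [hinvθ]; ring
  rw [hsplit]
  linarith [hA, hB]

/-- `∫₀^π max(cos x - √2/2, 0) dx = √2/2 - (π/4)(√2/2)` (the integrand is `cos x - cos(π/4)` on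
`[0, π/4]` and `0` on `[π/4, π]`). [folklore] -/
private theorem integral_max_cos_sub_sqrt_two : ∫ x in (0:ℝ)..π, max (Real.cos x - Real.sqrt 2 / 2) 0 =
    Real.sqrt 2 / 2 - π / 4 * (Real.sqrt 2 / 2) := by
  have hcont : Continuous fun x : ℝ => max (Real.cos x - Real.sqrt 2 / 2) 0 :=
    (Real.continuous_cos.sub continuous_const).max continuous_const
  have hsplit : ∫ x in (0:ℝ)..π, max (Real.cos x - Real.sqrt 2 / 2) 0 =
      (∫ x in (0:ℝ)..(π/4), max (Real.cos x - Real.sqrt 2 / 2) 0) +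
        ∫ x in (π/4)..π, max (Real.cos x - Real.sqrt 2 / 2) 0 := by
    rw [integral_add_adjacent_intervals] <;> exact hcont.intervalIntegrable _ _
  have h1 : ∫ x in (0:ℝ)..(π/4), max (Real.cos x - Real.sqrt 2 / 2) 0 =
      ∫ x in (0:ℝ)..(π/4), (Real.cos x - Real.sqrt 2 / 2) := by
    refine integral_congr fun x hx => ?_
    rw [Set.uIcc_of_le (by positivity)] at hx
    refine max_eq_left ?_
    rw [sub_nonneg, ← Real.cos_pi_div_four]
    exact Real.cos_le_cos_of_nonneg_of_le_pi hx.1 (by linarith [hx.2, Real.pi_pos]) hx.2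
  have h2 : ∫ x in (π/4)..π, max (Real.cos x - Real.sqrt 2 / 2) 0 = ∫ x in (π/4)..π, (0:ℝ) := by
    refine integral_congr fun x hx => ?_
    rw [Set.uIcc_of_le (by linarith [Real.pi_pos])] at hx
    refine max_eq_right ?_
    rw [sub_nonpos, ← Real.cos_pi_div_four]
    exact Real.cos_le_cos_of_nonneg_of_le_pi (by positivity) hx.2 hx.1
  rw [hsplit, h1, h2, intervalIntegral.integral_sub (Real.continuous_cos.intervalIntegrable _ _)
    (continuous_const.intervalIntegrable _ _), integral_cos, intervalIntegral.integral_const,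
    intervalIntegral.integral_zero, Real.sin_pi_div_four, Real.sin_zero]
  simp only [smul_eq_mul, sub_zero, add_zero]

/-- **Bathtub lower bound at the quarter-filling Fermi level** (`L ≥ 3`, `t ≥ 0`, `U = 0`, every
`N ≤ 2L`): `E_L(N) ≥ -√2·t·N - 4t (L (√2/2)(1 - π/4)/π + (1 - √2/2))`, the Lieb–Loss bound at
`μ = -√2 t` with the Riemann estimate for the threshold `cos k - √2/2`. [cite: LiebLoss1993, §8, Theorem 8.2] -/
theorem hubbardChain_groundEnergyAt_zero_ge_quarter [NeZero L] (hL : 3 ≤ L) {t : ℝ} (ht : 0 ≤ t)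
    {N : ℕ} (hN : N ≤ 2 * L) :
    -(Real.sqrt 2 * t) * N - 4 * t * (L * (Real.sqrt 2 / 2 * (1 - π / 4)) / π + (1 - Real.sqrt 2 / 2)) ≤
      groundEnergyAt (fermionTorusGraph 1 L) t 0 N := by
  have hc1 : Real.sqrt 2 / 2 ≤ 1 := by
    rw [← Real.cos_pi_div_four]; exact Real.cos_le_one _
  have h := FreeKinetic.hubbardTorus_groundEnergyAt_ge (d := 1) (L := L) hL t (le_refl (0 : ℝ))
    (-(Real.sqrt 2 * t)) (N := N) (by simpa using hN)
  have h1 : ∀ z : TorusSite 1 L, min (sdwBand t (cellCorner z) - -(Real.sqrt 2 * t)) 0 =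
      -(2 * t) * max (Real.cos (2 * π * ((z 0).val : ℕ) / L) - Real.sqrt 2 / 2) 0 := fun z => by
    rw [← siteBand_neg_ofTorusSite_eq_sdwBand, siteBand_neg_ofTorusSite, level_eq]
    set x := Real.cos (2 * π * ((z 0).val : ℕ) / L)
    rcases le_total (x - Real.sqrt 2 / 2) 0 with hx | hx
    · rw [max_eq_right hx, mul_zero, min_eq_right]
      nlinarith
    · rw [max_eq_left hx, min_eq_left]
      · ring
      · nlinarith
  have hs : ∑ z : TorusSite 1 L, min (sdwBand t (cellCorner z) - -(Real.sqrt 2 * t)) 0 =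
      -(2 * t) * ∑ j ∈ Finset.range L, max (Real.cos (2 * π * j / L) - Real.sqrt 2 / 2) 0 := by
    rw [Finset.sum_congr rfl fun z _ => h1 z, ← Finset.mul_sum]
    congr 1
    exact sum_torusSite_one_eq_sum_range L (fun j => max (Real.cos (2 * π * j / L) - Real.sqrt 2 / 2) 0)
  rw [hs] at h
  have hsum := sum_range_max_cos_sub_le (Real.sqrt 2 / 2) hc1 L (by omega)
  rw [integral_max_cos_sub_sqrt_two] at hsum
  have hneg : -(2 * t) * (L / π * (Real.sqrt 2 / 2 - π / 4 * (Real.sqrt 2 / 2)) + (1 - Real.sqrt 2 / 2)) ≤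
      -(2 * t) * ∑ j ∈ Finset.range L, max (Real.cos (2 * π * j / L) - Real.sqrt 2 / 2) 0 :=
    mul_le_mul_of_nonpos_left hsum (by linarith)
  have hfin : -(Real.sqrt 2 * t) * N - 4 * t * (L * (Real.sqrt 2 / 2 * (1 - π / 4)) / π + (1 - Real.sqrt 2 / 2)) =
      -(Real.sqrt 2 * t) * N +
        2 * (-(2 * t) * (L / π * (Real.sqrt 2 / 2 - π / 4 * (Real.sqrt 2 / 2)) + (1 - Real.sqrt 2 / 2))) := by
    ring
  rw [hfin]
  linarith

/-- `cos(2πj/L) ≥ √2/2` when `8j ≤ L`. [folklore] -/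
private theorem cos_ge_of_eight_mul_le {j L : ℕ} (hL : 0 < L) (h : 8 * j ≤ L) :
    Real.sqrt 2 / 2 ≤ Real.cos (2 * π * j / L) := by
  have hLr : (0 : ℝ) < L := by exact_mod_cast hL
  have h' : (8 * j : ℝ) ≤ L := by exact_mod_cast h
  rw [← Real.cos_pi_div_four]
  apply Real.cos_le_cos_of_nonneg_of_le_pi (by positivity) (by linarith [Real.pi_pos])
  rw [div_le_iff₀ hLr]; nlinarith [Real.pi_pos]

/-- `cos(2πj/L) ≥ √2/2` when `7L ≤ 8j` and `j ≤ L`. [folklore] -/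
private theorem cos_ge_of_seven_mul_le {j L : ℕ} (hL : 0 < L) (h : 7 * L ≤ 8 * j) (hj : j ≤ L) :
    Real.sqrt 2 / 2 ≤ Real.cos (2 * π * j / L) := by
  have hLr : (0 : ℝ) < L := by exact_mod_cast hL
  have h' : (7 * L : ℝ) ≤ 8 * j := by exact_mod_cast h
  have hj' : (j : ℝ) ≤ L := by exact_mod_cast hj
  rw [← Real.cos_pi_div_four, ← Real.cos_sub_two_pi (2 * π * j / L),
    show 2 * π * (j : ℝ) / L - 2 * π = -(2 * π - 2 * π * (j : ℝ) / L) by ring, Real.cos_neg]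
  apply Real.cos_le_cos_of_nonneg_of_le_pi
  · have : 2 * π * j / L ≤ 2 * π := by rw [div_le_iff₀ hLr]; nlinarith [Real.pi_pos]
    linarith
  · linarith [Real.pi_pos]
  · have : 7 * π / 4 ≤ 2 * π * j / L := by rw [le_div_iff₀ hLr]; nlinarith [Real.pi_pos]
    linarith

/-- `cos(2πj/L) ≤ √2/2` when `L ≤ 8j ≤ 7L`. [folklore] -/
private theorem cos_le_of_le_of_le {j L : ℕ} (hL : 0 < L) (h1 : L ≤ 8 * j) (h2 : 8 * j ≤ 7 * L) :
    Real.cos (2 * π * j / L) ≤ Real.sqrt 2 / 2 := by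
  have hLr : (0 : ℝ) < L := by exact_mod_cast hL
  have h1' : (L : ℝ) ≤ 8 * j := by exact_mod_cast h1
  have h2' : (8 * j : ℝ) ≤ 7 * L := by exact_mod_cast h2
  have hlo : π / 4 ≤ 2 * π * j / L := by rw [le_div_iff₀ hLr]; nlinarith [Real.pi_pos]
  have hhi : 2 * π * j / L ≤ 7 * π / 4 := by rw [div_le_iff₀ hLr]; nlinarith [Real.pi_pos]
  rw [← Real.cos_pi_div_four]
  rcases le_total (2 * π * (j : ℝ) / L) π with hle | hge
  · exact Real.cos_le_cos_of_nonneg_of_le_pi (by positivity) hle hlo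
  · rw [← Real.cos_sub_two_pi (2 * π * j / L),
      show 2 * π * (j : ℝ) / L - 2 * π = -(2 * π - 2 * π * (j : ℝ) / L) by ring, Real.cos_neg]
    exact Real.cos_le_cos_of_nonneg_of_le_pi (by positivity) (by linarith [Real.pi_pos]) (by linarith)

/-- **Exact free-fermion energy of the quarter-filled ring `L = 8m`, `N = 4m`** (`t ≥ 0`, `U = 0`):
`E_{8m}(4m) = -4t Σ_{j ∈ [0,m) ∪ [7m,8m)} cos(2πj/(8m))` — the doubly filled Fermi sea `cos k > √2/2`
plus the mode `k = 7π/4`, a bathtub minimiser at level `μ = -√2 t`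
(`FreeFermionTorus.hubbardTorus_groundEnergyAt_zero_eq_two_mul`). Stated with free ring-length and
electron-number variables. [cite: LiebWuPhysicaA2003, §4 and §6 Remark (A)][cite: LiebLoss1993, §8, Theorem 8.2] -/
theorem hubbardChain_groundEnergyAt_zero_quarter_eq (m : ℕ) (hm : 1 ≤ m) {Lr Nr : ℕ} (hLr : Lr = 8 * m)
    (hNr : Nr = 4 * m) {t : ℝ} (ht : 0 ≤ t) :
    groundEnergyAt (fermionTorusGraph 1 Lr) t 0 Nr =
      -(4 * t) * ∑ j ∈ Finset.range m ∪ Finset.Ico (7 * m) (8 * m), Real.cos (2 * π * j / Lr) := by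
  classical
  subst hLr; subst hNr
  haveI : NeZero (8 * m) := ⟨by omega⟩
  set L : ℕ := 8 * m with hLdef
  set A : Finset ℕ := Finset.range m ∪ Finset.Ico (7 * m) L with hA
  have hLpos : 0 < L := by omega
  have hAL : ∀ j ∈ A, j < L := by
    intro j hj
    rcases Finset.mem_union.1 hj with h | h
    · have := Finset.mem_range.1 h; omega
    · exact (Finset.mem_Ico.1 h).2
  have hcardA : A.card = 2 * m := by
    rw [hA, Finset.card_union_of_disjoint, Finset.card_range, Nat.card_Ico]
    · omega
    · exact Finset.disjoint_left.2 fun j h1 h2 => by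
        have := Finset.mem_range.1 h1; have := (Finset.mem_Ico.1 h2).1; omega
  set S : Finset (TorusSite 1 L) := A.image (fun j : ℕ => fun _ : Fin 1 => (j : ZMod L)) with hS
  have hinj : Set.InjOn (fun j : ℕ => fun _ : Fin 1 => (j : ZMod L)) ↑A := by
    intro j hj j' hj' h
    have h0 := congrArg ZMod.val (congrFun h 0)
    rwa [ZMod.val_cast_of_lt (hAL j (Finset.mem_coe.1 hj)),
      ZMod.val_cast_of_lt (hAL j' (Finset.mem_coe.1 hj'))] at h0
  have hmem : ∀ k : TorusSite 1 L, k ∈ S ↔ (k 0).val ∈ A := fun k => by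
    constructor
    · intro h
      obtain ⟨j, hj, rfl⟩ := Finset.mem_image.1 h
      show ((j : ZMod L)).val ∈ A
      rwa [ZMod.val_cast_of_lt (hAL j hj)]
    · intro h
      refine Finset.mem_image.2 ⟨(k 0).val, h, funext fun i => ?_⟩
      rw [Fin.fin_one_eq_zero i]
      exact ZMod.natCast_zmod_val (k 0)
  have hcardS : S.card = 2 * m := by rw [hS, Finset.card_image_of_injOn hinj, hcardA]
  have hsea : ∀ k ∈ S, -(t * (2 * ∑ i, Real.cos (latticeMomentum L k i))) ≤ -(Real.sqrt 2 * t) := by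
    intro k hk
    have hj := (hmem k).1 hk
    rw [level_eq, neg_le_neg_iff]
    have hcos : Real.sqrt 2 / 2 ≤ Real.cos (2 * π * ((k 0).val : ℕ) / L) := by
      rcases Finset.mem_union.1 hj with h | h
      · exact cos_ge_of_eight_mul_le hLpos (by have := Finset.mem_range.1 h; omega)
      · have h' := Finset.mem_Ico.1 h
        exact cos_ge_of_seven_mul_le hLpos (by omega) (by omega)
    nlinarith
  have hsea' : ∀ k ∉ S, -(Real.sqrt 2 * t) ≤ -(t * (2 * ∑ i, Real.cos (latticeMomentum L k i))) := by
    intro k hk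
    have hj : (k 0).val ∉ A := fun h => hk ((hmem k).2 h)
    have hjL : (k 0).val < L := ZMod.val_lt _
    have h1 : ¬ (k 0).val < m := fun h => hj (Finset.mem_union.2 (Or.inl (Finset.mem_range.2 h)))
    have h2 : ¬ (7 * m ≤ (k 0).val) := fun h =>
      hj (Finset.mem_union.2 (Or.inr (Finset.mem_Ico.2 ⟨h, hjL⟩)))
    rw [level_eq, neg_le_neg_iff]
    have hcos := cos_le_of_le_of_le (j := (k 0).val) hLpos (by omega) (by omega)
    nlinarith
  have hE := FreeFermionTorus.hubbardTorus_groundEnergyAt_zero_eq_two_mul (d := 1) (L := L)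
    (by omega) t (-(Real.sqrt 2 * t)) S hsea hsea'
  rw [hcardS, show 2 * (2 * m) = 4 * m by ring] at hE
  rw [hE, hS, Finset.sum_image hinj]
  have hterm : ∀ j ∈ A,
      t * (2 * ∑ i, Real.cos (latticeMomentum L ((fun j : ℕ => fun _ : Fin 1 => (j : ZMod L)) j) i)) =
        2 * t * Real.cos (2 * π * j / L) := fun j hj => by
    rw [level_eq]
    simp only [ZMod.val_cast_of_lt (hAL j hj)]
  rw [Finset.sum_congr rfl hterm, ← Finset.mul_sum]
  ring

/-- The quarter-filling Fermi-sea sum of the ring `L = 8m` dominates its Riemann integral: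
`Σ_{j<m} cos(πj/4m) + Σ_{7m ≤ j < 8m} cos(πj/4m) = 2Σ_{j<m} cos(πj/4m) - 1 + √2/2 ≥ 4√2m/π - 1 + √2/2`.
[folklore] -/
private theorem fermiSum_quarter_ge (m : ℕ) (hm : 1 ≤ m) :
    4 * Real.sqrt 2 * m / π - 1 + Real.sqrt 2 / 2 ≤
      ∑ j ∈ Finset.range m ∪ Finset.Ico (7 * m) (8 * m), Real.cos (2 * π * j / (8 * m : ℕ)) := by
  have hmpos : (0 : ℝ) < m := by exact_mod_cast hm
  set θ : ℝ := 2 * π / (8 * m : ℕ) with hθdef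
  have hθ : 0 < θ := by rw [hθdef]; positivity
  have hθm : θ * m = π / 4 := by rw [hθdef]; push_cast; field_simp; ring
  have h2θ : 2 * (Real.sqrt 2 / 2 / θ) - 1 + Real.sqrt 2 / 2 = 4 * Real.sqrt 2 * m / π - 1 + Real.sqrt 2 / 2 := by
    rw [hθdef]; push_cast; field_simp; ring
  have hsummand : ∀ j : ℕ, Real.cos (2 * π * j / (8 * m : ℕ)) = Real.cos (θ * j) := fun j => by
    rw [hθdef]; ring_nf
  simp_rw [hsummand]
  have hdisj : Disjoint (Finset.range m) (Finset.Ico (7 * m) (8 * m)) :=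
    Finset.disjoint_left.2 fun j h1 h2 => by
      have := Finset.mem_range.1 h1; have := (Finset.mem_Ico.1 h2).1; omega
  rw [Finset.sum_union hdisj]
  have hanti : AntitoneOn (fun u : ℝ => Real.cos (θ * u)) (Icc (0 : ℝ) (0 + m)) := by
    intro x hx y hy hxy
    simp only [zero_add] at hx hy
    exact Real.cos_le_cos_of_nonneg_of_le_pi (by nlinarith [hx.1, hθ.le])
      (by nlinarith [hy.2, hθ.le, hθm, Real.pi_pos]) (mul_le_mul_of_nonneg_left hxy hθ.le)
  have hint : ∫ u in (0 : ℝ)..(0 + m), Real.cos (θ * u) = Real.sqrt 2 / 2 / θ := by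
    have h := intervalIntegral.integral_comp_mul_left (fun x => Real.cos x) hθ.ne' (a := 0) (b := (m : ℝ))
    simp only [mul_zero] at h
    rw [zero_add, h, hθm, integral_cos, Real.sin_pi_div_four, Real.sin_zero, smul_eq_mul]
    ring
  have hA : Real.sqrt 2 / 2 / θ ≤ ∑ j ∈ Finset.range m, Real.cos (θ * j) := by
    have h := hanti.integral_le_sum
    beta_reduce at h
    rw [hint] at h
    simpa using h
  have hB : ∑ j ∈ Finset.Ico (7 * m) (8 * m), Real.cos (θ * j) =
      ∑ j ∈ Finset.range m, Real.cos (θ * j) - 1 + Real.sqrt 2 / 2 := by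
    have hrefl := Finset.sum_Ico_reflect (fun j : ℕ => Real.cos (θ * j)) 1 (m := m + 1) (n := 8 * m)
      (by omega)
    beta_reduce at hrefl
    rw [show 8 * m + 1 - (m + 1) = 7 * m by omega, show 8 * m + 1 - 1 = 8 * m by omega] at hrefl
    rw [← hrefl]
    have hper : ∀ j ∈ Finset.Ico 1 (m + 1), Real.cos (θ * ((8 * m - j : ℕ) : ℝ)) = Real.cos (θ * j) := by
      intro j hj
      have hj8 : j ≤ 8 * m := by have := (Finset.mem_Ico.1 hj).2; omega
      rw [Nat.cast_sub hj8, mul_sub]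
      have h8 : θ * ((8 * m : ℕ) : ℝ) = 2 * π := by rw [hθdef]; field_simp
      rw [h8, show 2 * π - θ * (j : ℝ) = -(θ * (j : ℝ) - 2 * π) by ring, Real.cos_neg,
        Real.cos_sub_two_pi]
    have hcm : Real.cos (θ * (m : ℕ)) = Real.sqrt 2 / 2 := by rw [hθm, Real.cos_pi_div_four]
    have hc0 : Real.cos (θ * (0 : ℕ)) = 1 := by simp
    rw [Finset.sum_congr rfl hper, Finset.sum_Ico_succ_top hm, hcm, Finset.range_eq_Ico,
      Finset.sum_eq_sum_Ico_succ_bot hm, hc0]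
    ring
  rw [hB, ← h2θ]
  linarith

/-- **Free-fermion upper bound on the quarter-filled rings `L = 8m`** (`t ≥ 0`, `U = 0`):
`E_{8m}(4m) ≤ -4t (4√2m/π - 1 + √2/2)`. [cite: LiebWuPhysicaA2003, §4 and §6 Remark (A)] -/
theorem hubbardChain_groundEnergyAt_zero_quarter_le (m : ℕ) (hm : 1 ≤ m) {Lr Nr : ℕ} (hLr : Lr = 8 * m)
    (hNr : Nr = 4 * m) {t : ℝ} (ht : 0 ≤ t) :
    groundEnergyAt (fermionTorusGraph 1 Lr) t 0 Nr ≤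
      -(4 * t) * (4 * Real.sqrt 2 * m / π - 1 + Real.sqrt 2 / 2) := by
  rw [hubbardChain_groundEnergyAt_zero_quarter_eq m hm hLr hNr ht, hLr]
  exact mul_le_mul_of_nonpos_left (fermiSum_quarter_ge m hm) (by linarith)

/-- **The quarter-filled Hubbard chain at `U = 0`: `e(t, 0; 1/2) = -2√2·t/π`** (`t ≥ 0`), i.e.
`-(4t/π) sin(π n/2)` at `n = 1/2`: the tree's `ThermodynamicLimit.hubbardChainEnergyDensityAt t 0 1 2`
(the limit of `E_{2m}(m)/(2m)`) equals the free-fermion value. Upper bound along the rings `L = 8m`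
(`hubbardChain_groundEnergyAt_zero_quarter_le` with `hubbardChainEnergyDensityAt_le_of_le`), lower bound
on every ring `L = 2m` (`hubbardChain_groundEnergyAt_zero_ge_quarter` with
`hubbardChainEnergyDensityAt_ge_of_forall_ge`). Lieb–Wu (2003) §4 with §6 Remark (A) (`U = 0`:
`ρ₀ = 1/π` on the Fermi sea). [cite: LiebWuPhysicaA2003, §4 and §6 Remark (A)] -/
theorem hubbardChainEnergyDensityAt_zero_half {t : ℝ} (ht : 0 ≤ t) :
    hubbardChainEnergyDensityAt t 0 1 2 = -(2 * Real.sqrt 2 * t) / π := by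
  have hs2 : 0 ≤ Real.sqrt 2 := Real.sqrt_nonneg 2
  refine le_antisymm ?_ ?_
  · refine le_of_forall_pos_le_add fun ε hε => ?_
    obtain ⟨m, hm⟩ := exists_nat_gt (3 * t / ε)
    have hM : (0 : ℝ) < ((m + 1 : ℕ) : ℝ) := by positivity
    have hE := hubbardChain_groundEnergyAt_zero_quarter_le (m + 1) (by omega)
      (Lr := 2 * (4 * (m + 1))) (Nr := 1 * (4 * (m + 1))) (by ring) (by ring) ht
    have h := hubbardChainEnergyDensityAt_le_of_le t (le_refl (0 : ℝ)) (p := 1) (q := 2) (by norm_num)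
      (by norm_num) (m := 4 * (m + 1)) (by omega) hE
    rw [abs_of_nonneg ht] at h
    have hcalc : -(4 * t) * (4 * Real.sqrt 2 * ((m + 1 : ℕ) : ℝ) / π - 1 + Real.sqrt 2 / 2) /
        ((2 * (4 * (m + 1)) : ℕ) : ℝ) + 8 * t / ((2 * (4 * (m + 1)) : ℕ) : ℝ) =
        -(2 * Real.sqrt 2 * t) / π + (6 - Real.sqrt 2) * t / (4 * ((m + 1 : ℕ) : ℝ)) := by
      push_cast; field_simp; ring
    rw [hcalc] at h
    have h3 : (6 - Real.sqrt 2) * t / (4 * ((m + 1 : ℕ) : ℝ)) ≤ ε := by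
      rw [div_le_iff₀ (by positivity)]
      have h' : 3 * t / ε < m := hm
      rw [div_lt_iff₀ hε] at h'
      have hm1 : (m : ℝ) ≤ ((m + 1 : ℕ) : ℝ) := by push_cast; linarith
      nlinarith [h', hm1, hε.le, hs2, ht]
    linarith
  · refine le_of_forall_pos_le_add fun ε hε => ?_
    obtain ⟨m₀, hm₀⟩ := exists_nat_gt (2 * t / ε)
    have key : ∀ m : ℕ, m₀ + 2 ≤ m →
        -(2 * Real.sqrt 2 * t) / π - ε ≤
          groundEnergyAt (fermionTorusGraph 1 (2 * m)) t 0 (1 * m) / ((2 * m : ℕ) : ℝ) := by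
      intro m hmm
      haveI : NeZero (2 * m) := ⟨by omega⟩
      have hLpos : (0 : ℝ) < ((2 * m : ℕ) : ℝ) := by exact_mod_cast (by omega : 0 < 2 * m)
      have hE := hubbardChain_groundEnergyAt_zero_ge_quarter (L := 2 * m) (by omega) ht (N := 1 * m) (by omega)
      rw [le_div_iff₀ hLpos]
      have hεm : 2 * t ≤ ε * m := by
        have h1 : 2 * t / ε < m₀ := hm₀
        rw [div_lt_iff₀ hε] at h1
        have h2 : (m₀ : ℝ) ≤ m := by exact_mod_cast (by omega : m₀ ≤ m)
        nlinarith [h1, h2, hε.le]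
      have hid : (-(2 * Real.sqrt 2 * t) / π - ε) * ((2 * m : ℕ) : ℝ) =
          -(Real.sqrt 2 * t) * ((1 * m : ℕ) : ℝ) -
            4 * t * (((2 * m : ℕ) : ℝ) * (Real.sqrt 2 / 2 * (1 - π / 4)) / π + (1 - Real.sqrt 2 / 2))
            + (4 * t * (1 - Real.sqrt 2 / 2) - 2 * ε * m) := by
        push_cast; field_simp; ring
      rw [hid]
      have hpos : 0 ≤ 1 - Real.sqrt 2 / 2 := by
        rw [← Real.cos_pi_div_four]; linarith [Real.cos_le_one (π / 4)]
      nlinarith [hE, hεm, hpos, ht]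
    have h := hubbardChainEnergyDensityAt_ge_of_forall_ge t (le_refl (0 : ℝ)) (p := 1) (q := 2)
      (by norm_num) (by norm_num) (m₀ + 2) key
    linarith


/-! ### §F Every filling `n = p/q ≤ 2` at `U = 0`: `e(t, 0; p/q) = -(4t/π) sin(πp/2q)`

The general case of §C and §E: Fermi momentum `k_F = πp/(2q) ∈ (0, π]`, Fermi level `μ = -2t cos k_F`;
bathtub bound on every ring `L = qm`, `N = pm` with the Riemann estimate for the threshold
`cos k - cos k_F` (`∫₀^π max(cos x - cos k_F, 0) dx = sin k_F - k_F cos k_F`); exact Fermi-sea energy of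
the rings `L = 4qm'`, `N = 4pm'`; the limit along `hubbardChainEnergyDensityAt t 0 p q`. -/

/-- `∫₀^π max(cos x - cos a, 0) dx = sin a - a cos a` for `0 ≤ a ≤ π`. [folklore] -/
private theorem integral_max_cos_sub_cos {a : ℝ} (ha0 : 0 ≤ a) (haπ : a ≤ π) :
    ∫ x in (0:ℝ)..π, max (Real.cos x - Real.cos a) 0 = Real.sin a - a * Real.cos a := by
  have hcont : Continuous fun x : ℝ => max (Real.cos x - Real.cos a) 0 :=
    (Real.continuous_cos.sub continuous_const).max continuous_const
  have hsplit : ∫ x in (0:ℝ)..π, max (Real.cos x - Real.cos a) 0 =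
      (∫ x in (0:ℝ)..a, max (Real.cos x - Real.cos a) 0) +
        ∫ x in a..π, max (Real.cos x - Real.cos a) 0 := by
    rw [integral_add_adjacent_intervals] <;> exact hcont.intervalIntegrable _ _
  have h1 : ∫ x in (0:ℝ)..a, max (Real.cos x - Real.cos a) 0 =
      ∫ x in (0:ℝ)..a, (Real.cos x - Real.cos a) := by
    refine integral_congr fun x hx => ?_
    rw [Set.uIcc_of_le ha0] at hx
    refine max_eq_left ?_
    rw [sub_nonneg]
    exact Real.cos_le_cos_of_nonneg_of_le_pi hx.1 haπ hx.2
  have h2 : ∫ x in a..π, max (Real.cos x - Real.cos a) 0 = ∫ x in a..π, (0:ℝ) := by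
    refine integral_congr fun x hx => ?_
    rw [Set.uIcc_of_le haπ] at hx
    refine max_eq_right ?_
    rw [sub_nonpos]
    exact Real.cos_le_cos_of_nonneg_of_le_pi ha0 hx.2 hx.1
  rw [hsplit, h1, h2, intervalIntegral.integral_sub (Real.continuous_cos.intervalIntegrable _ _)
    (continuous_const.intervalIntegrable _ _), integral_cos, intervalIntegral.integral_const,
    intervalIntegral.integral_zero, Real.sin_zero]
  simp only [smul_eq_mul, sub_zero, add_zero]

/-- **Bathtub lower bound at an arbitrary trial Fermi momentum `a ∈ [0, π]`** (`L ≥ 3`, `t ≥ 0`,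
`U = 0`, every `N ≤ 2L`): `E_L(N) ≥ -2t cos(a)·N - 4t (L (sin a - a cos a)/π + (1 - cos a))`
(Lieb–Loss at `μ = -2t cos a` and the Riemann estimate `sum_range_max_cos_sub_le`).
[cite: LiebLoss1993, §8, Theorem 8.2] -/
theorem hubbardChain_groundEnergyAt_zero_ge_fermi [NeZero L] (hL : 3 ≤ L) {t : ℝ} (ht : 0 ≤ t)
    {N : ℕ} (hN : N ≤ 2 * L) {a : ℝ} (ha0 : 0 ≤ a) (haπ : a ≤ π) :
    -(2 * t * Real.cos a) * N - 4 * t * (L / π * (Real.sin a - a * Real.cos a) + (1 - Real.cos a)) ≤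
      groundEnergyAt (fermionTorusGraph 1 L) t 0 N := by
  have hc1 : Real.cos a ≤ 1 := Real.cos_le_one a
  have h := FreeKinetic.hubbardTorus_groundEnergyAt_ge (d := 1) (L := L) hL t (le_refl (0 : ℝ))
    (-(2 * t * Real.cos a)) (N := N) (by simpa using hN)
  have h1 : ∀ z : TorusSite 1 L, min (sdwBand t (cellCorner z) - -(2 * t * Real.cos a)) 0 =
      -(2 * t) * max (Real.cos (2 * π * ((z 0).val : ℕ) / L) - Real.cos a) 0 := fun z => by
    rw [← siteBand_neg_ofTorusSite_eq_sdwBand, siteBand_neg_ofTorusSite, level_eq]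
    set x := Real.cos (2 * π * ((z 0).val : ℕ) / L)
    rcases le_total (x - Real.cos a) 0 with hx | hx
    · rw [max_eq_right hx, mul_zero, min_eq_right]
      nlinarith
    · rw [max_eq_left hx, min_eq_left]
      · ring
      · nlinarith
  have hs : ∑ z : TorusSite 1 L, min (sdwBand t (cellCorner z) - -(2 * t * Real.cos a)) 0 =
      -(2 * t) * ∑ j ∈ Finset.range L, max (Real.cos (2 * π * j / L) - Real.cos a) 0 := by
    rw [Finset.sum_congr rfl fun z _ => h1 z, ← Finset.mul_sum]
    congr 1
    exact sum_torusSite_one_eq_sum_range L (fun j => max (Real.cos (2 * π * j / L) - Real.cos a) 0)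
  rw [hs] at h
  have hsum := sum_range_max_cos_sub_le (Real.cos a) hc1 L (by omega)
  rw [integral_max_cos_sub_cos ha0 haπ] at hsum
  have hneg : -(2 * t) * (L / π * (Real.sin a - a * Real.cos a) + (1 - Real.cos a)) ≤
      -(2 * t) * ∑ j ∈ Finset.range L, max (Real.cos (2 * π * j / L) - Real.cos a) 0 :=
    mul_le_mul_of_nonpos_left hsum (by linarith)
  have hfin : -(2 * t * Real.cos a) * N - 4 * t * (L / π * (Real.sin a - a * Real.cos a) + (1 - Real.cos a)) =
      -(2 * t * Real.cos a) * N +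
        2 * (-(2 * t) * (L / π * (Real.sin a - a * Real.cos a) + (1 - Real.cos a))) := by ring
  rw [hfin]
  linarith

/-- `cos a ≤ cos x` for `0 ≤ 2π - a ≤ x ≤ 2π`, `a ≤ π` (reflection). [folklore] -/
private theorem cos_le_cos_of_two_pi_sub_le {x a : ℝ} (haπ : a ≤ π) (h : 2 * π - a ≤ x)
    (hx : x ≤ 2 * π) : Real.cos a ≤ Real.cos x := by
  rw [← Real.cos_sub_two_pi x, show x - 2 * π = -(2 * π - x) by ring, Real.cos_neg]
  exact Real.cos_le_cos_of_nonneg_of_le_pi (by linarith) haπ (by linarith)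

/-- `cos x ≤ cos a` for `a ≤ x ≤ 2π - a`, `0 ≤ a`. [folklore] -/
private theorem cos_le_cos_of_mem {x a : ℝ} (ha0 : 0 ≤ a) (h1 : a ≤ x)
    (h2 : x ≤ 2 * π - a) : Real.cos x ≤ Real.cos a := by
  rcases le_total x π with hle | hge
  · exact Real.cos_le_cos_of_nonneg_of_le_pi ha0 hle h1
  · rw [← Real.cos_sub_two_pi x, show x - 2 * π = -(2 * π - x) by ring, Real.cos_neg]
    exact Real.cos_le_cos_of_nonneg_of_le_pi ha0 (by linarith) (by linarith)

/-- **Exact free-fermion energy of the ring `L = 4qm'` with `N = 4pm'` electrons** (`1 ≤ p ≤ 2q`,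
`t ≥ 0`, `U = 0`): `E_L(N) = -4t Σ_{j ∈ [0,pm') ∪ [L-pm', L)} cos(2πj/L)`, the doubly filled Fermi sea
`{k : cos k > cos k_F}`, `k_F = πp/(2q)`, together with the mode `k = 2π - k_F` — a bathtub minimiser
at the Fermi level `μ = -2t cos k_F` (`FreeFermionTorus.hubbardTorus_groundEnergyAt_zero_eq_two_mul`).
Free ring-length / electron-number variables. [cite: LiebWuPhysicaA2003, §4 and §6 Remark (A)][cite: LiebLoss1993, §8, Theorem 8.2] -/
theorem hubbardChain_groundEnergyAt_zero_filling_eq {p q : ℕ} (hp1 : 1 ≤ p) (hp : p ≤ 2 * q) (m : ℕ)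
    (hm : 1 ≤ m) {Lr Nr : ℕ} (hLr : Lr = 4 * q * m) (hNr : Nr = 4 * p * m) {t : ℝ} (ht : 0 ≤ t) :
    groundEnergyAt (fermionTorusGraph 1 Lr) t 0 Nr =
      -(4 * t) * ∑ j ∈ Finset.range (p * m) ∪ Finset.Ico (Lr - p * m) Lr, Real.cos (2 * π * j / Lr) := by
  classical
  have hq : 1 ≤ q := by omega
  subst hLr; subst hNr
  haveI : NeZero (4 * q * m) := ⟨by positivity⟩
  set L : ℕ := 4 * q * m with hLdef
  set A : Finset ℕ := Finset.range (p * m) ∪ Finset.Ico (L - p * m) L with hA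
  have hLpos : 0 < L := by positivity
  have hpmL : 2 * (p * m) ≤ L := by
    rw [hLdef]; nlinarith
  have hAL : ∀ j ∈ A, j < L := by
    intro j hj
    rcases Finset.mem_union.1 hj with h | h
    · have := Finset.mem_range.1 h; omega
    · exact (Finset.mem_Ico.1 h).2
  have hcardA : A.card = 2 * (p * m) := by
    rw [hA, Finset.card_union_of_disjoint, Finset.card_range, Nat.card_Ico]
    · omega
    · exact Finset.disjoint_left.2 fun j h1 h2 => by
        have := Finset.mem_range.1 h1; have := (Finset.mem_Ico.1 h2).1; omega
  set S : Finset (TorusSite 1 L) := A.image (fun j : ℕ => fun _ : Fin 1 => (j : ZMod L)) with hS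
  have hinj : Set.InjOn (fun j : ℕ => fun _ : Fin 1 => (j : ZMod L)) ↑A := by
    intro j hj j' hj' h
    have h0 := congrArg ZMod.val (congrFun h 0)
    rwa [ZMod.val_cast_of_lt (hAL j (Finset.mem_coe.1 hj)),
      ZMod.val_cast_of_lt (hAL j' (Finset.mem_coe.1 hj'))] at h0
  have hmem : ∀ k : TorusSite 1 L, k ∈ S ↔ (k 0).val ∈ A := fun k => by
    constructor
    · intro h
      obtain ⟨j, hj, rfl⟩ := Finset.mem_image.1 h
      show ((j : ZMod L)).val ∈ A
      rwa [ZMod.val_cast_of_lt (hAL j hj)]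
    · intro h
      refine Finset.mem_image.2 ⟨(k 0).val, h, funext fun i => ?_⟩
      rw [Fin.fin_one_eq_zero i]
      exact ZMod.natCast_zmod_val (k 0)
  have hcardS : S.card = 2 * (p * m) := by rw [hS, Finset.card_image_of_injOn hinj, hcardA]
  -- the Fermi momentum and the angles
  have hLr : (0 : ℝ) < L := by exact_mod_cast hLpos
  have hqr : (0 : ℝ) < q := by exact_mod_cast hq
  have hkF0 : 0 ≤ π * p / (2 * q) := by positivity
  have hkFπ : π * p / (2 * q) ≤ π := by
    rw [div_le_iff₀ (by positivity)]
    have : (p : ℝ) ≤ 2 * q := by exact_mod_cast hp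
    nlinarith [Real.pi_pos]
  have hLreal : (L : ℝ) = 4 * q * m := by rw [hLdef]; push_cast; ring
  -- angle of the representative `j`: `2πj/L` compared with `k_F = πp/(2q) = 2π(pm)/L`
  have hangle_le : ∀ j : ℕ, j ≤ p * m → 2 * π * (j : ℝ) / L ≤ π * p / (2 * q) := by
    intro j hj
    have hj' : (j : ℝ) ≤ p * m := by exact_mod_cast hj
    rw [hLreal, div_le_div_iff₀ (by positivity) (by positivity)]
    have hmul := mul_le_mul_of_nonneg_left hj' (by positivity : (0:ℝ) ≤ 4 * π * q)
    nlinarith [hmul]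
  have hangle_ge : ∀ j : ℕ, p * m ≤ j → π * p / (2 * q) ≤ 2 * π * (j : ℝ) / L := by
    intro j hj
    have hj' : (p : ℝ) * m ≤ j := by exact_mod_cast hj
    rw [hLreal, div_le_div_iff₀ (by positivity) (by positivity)]
    have hmul := mul_le_mul_of_nonneg_left hj' (by positivity : (0:ℝ) ≤ 4 * π * q)
    nlinarith [hmul]
  have hangle_ge' : ∀ j : ℕ, L - p * m ≤ j → 2 * π - π * p / (2 * q) ≤ 2 * π * (j : ℝ) / L := by
    intro j hj
    have hj' : (L : ℝ) - p * m ≤ j := by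
      have : L - p * m + p * m = L := by omega
      have h' : ((L - p * m : ℕ) : ℝ) + p * m = L := by exact_mod_cast this
      have h'' : ((L - p * m : ℕ) : ℝ) ≤ j := by exact_mod_cast hj
      linarith
    rw [hLreal] at hj' ⊢
    rw [le_div_iff₀ (by positivity)]
    have h4 : 2 * π - π * ↑p / (2 * ↑q) = 2 * π * (4 * q * m - p * m) / (4 * q * m) := by
      field_simp; ring
    rw [h4, div_mul_cancel₀ _ (by positivity)]
    nlinarith [Real.pi_pos]
  have hangle_le' : ∀ j : ℕ, j + 1 ≤ L - p * m → 2 * π * (j : ℝ) / L ≤ 2 * π - π * p / (2 * q) := by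
    intro j hj
    have hj' : (j : ℝ) ≤ L - p * m := by
      have : j + p * m ≤ L := by omega
      have h' : ((j + p * m : ℕ) : ℝ) ≤ L := by exact_mod_cast this
      push_cast at h'; linarith
    rw [hLreal] at hj' ⊢
    rw [div_le_iff₀ (by positivity)]
    have h4 : 2 * π - π * ↑p / (2 * ↑q) = 2 * π * (4 * q * m - p * m) / (4 * q * m) := by
      field_simp; ring
    rw [h4, div_mul_cancel₀ _ (by positivity)]
    nlinarith [Real.pi_pos]
  have hangle_2pi : ∀ j : ℕ, j < L → 2 * π * (j : ℝ) / L ≤ 2 * π := by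
    intro j hj
    have hj' : (j : ℝ) ≤ L := by exact_mod_cast hj.le
    rw [div_le_iff₀ hLr]; nlinarith [Real.pi_pos]
  -- Fermi-sea conditions at `μ = -2t cos k_F`
  have hsea : ∀ k ∈ S, -(t * (2 * ∑ i, Real.cos (latticeMomentum L k i))) ≤
      -(2 * t * Real.cos (π * p / (2 * q))) := by
    intro k hk
    have hj := (hmem k).1 hk
    have hjL : (k 0).val < L := ZMod.val_lt _
    rw [level_eq, neg_le_neg_iff]
    have hcos : Real.cos (π * p / (2 * q)) ≤ Real.cos (2 * π * ((k 0).val : ℕ) / L) := by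
      rcases Finset.mem_union.1 hj with h | h
      · have h' := Finset.mem_range.1 h
        exact Real.cos_le_cos_of_nonneg_of_le_pi (by positivity) hkFπ (hangle_le _ h'.le)
      · have h' := Finset.mem_Ico.1 h
        exact cos_le_cos_of_two_pi_sub_le hkFπ (hangle_ge' _ h'.1) (hangle_2pi _ hjL)
    nlinarith
  have hsea' : ∀ k ∉ S, -(2 * t * Real.cos (π * p / (2 * q))) ≤
      -(t * (2 * ∑ i, Real.cos (latticeMomentum L k i))) := by
    intro k hk
    have hj : (k 0).val ∉ A := fun h => hk ((hmem k).2 h)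
    have hjL : (k 0).val < L := ZMod.val_lt _
    have h1 : ¬ (k 0).val < p * m := fun h => hj (Finset.mem_union.2 (Or.inl (Finset.mem_range.2 h)))
    have h2 : ¬ (L - p * m ≤ (k 0).val) := fun h =>
      hj (Finset.mem_union.2 (Or.inr (Finset.mem_Ico.2 ⟨h, hjL⟩)))
    rw [level_eq, neg_le_neg_iff]
    have hcos : Real.cos (2 * π * ((k 0).val : ℕ) / L) ≤ Real.cos (π * p / (2 * q)) :=
      cos_le_cos_of_mem hkF0 (hangle_ge _ (by omega)) (hangle_le' _ (by omega))
    nlinarith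
  have hL3 : 3 ≤ L := by
    rw [hLdef]
    calc 3 ≤ 4 * 1 * 1 := by norm_num
      _ ≤ 4 * q * m := Nat.mul_le_mul (Nat.mul_le_mul_left 4 hq) hm
  have hE := FreeFermionTorus.hubbardTorus_groundEnergyAt_zero_eq_two_mul (d := 1) (L := L)
    hL3 t (-(2 * t * Real.cos (π * p / (2 * q)))) S hsea hsea'
  rw [hcardS, show 2 * (2 * (p * m)) = 4 * p * m by ring] at hE
  rw [hE, hS, Finset.sum_image hinj]
  have hterm : ∀ j ∈ A,
      t * (2 * ∑ i, Real.cos (latticeMomentum L ((fun j : ℕ => fun _ : Fin 1 => (j : ZMod L)) j) i)) =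
        2 * t * Real.cos (2 * π * j / L) := fun j hj => by
    rw [level_eq]
    simp only [ZMod.val_cast_of_lt (hAL j hj)]
  rw [Finset.sum_congr rfl hterm, ← Finset.mul_sum]
  ring

/-- The Fermi-sea sum at filling `p/q` on the ring `L = 4qm` dominates its Riemann integral:
`Σ_{j<pm} cos(2πj/L) + Σ_{L-pm ≤ j < L} cos(2πj/L) = 2Σ_{j<pm} cos(2πj/L) - 1 + cos k_F ≥ (L/π) sin k_F - 1 + cos k_F`,
`k_F = πp/(2q)`. [folklore] -/
private theorem fermiSum_filling_ge {p q : ℕ} (hp1 : 1 ≤ p) (hp : p ≤ 2 * q) (m : ℕ) (hm : 1 ≤ m) :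
    (4 * q * m : ℕ) / π * Real.sin (π * p / (2 * q)) - 1 + Real.cos (π * p / (2 * q)) ≤
      ∑ j ∈ Finset.range (p * m) ∪ Finset.Ico (4 * q * m - p * m) (4 * q * m),
        Real.cos (2 * π * j / (4 * q * m : ℕ)) := by
  have hq : 1 ≤ q := by omega
  have hmpos : (0 : ℝ) < m := by exact_mod_cast hm
  have hqr : (0 : ℝ) < q := by exact_mod_cast hq
  have hpm : 1 ≤ p * m := Nat.mul_pos hp1 hm  -- as `0 < p * m`
  set θ : ℝ := 2 * π / (4 * q * m : ℕ) with hθdef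
  have hθ : 0 < θ := by rw [hθdef]; positivity
  have hθpm : θ * ((p * m : ℕ) : ℝ) = π * p / (2 * q) := by rw [hθdef]; push_cast; field_simp; ring
  have hkFπ : π * p / (2 * q) ≤ π := by
    rw [div_le_iff₀ (by positivity)]
    have : (p : ℝ) ≤ 2 * q := by exact_mod_cast hp
    nlinarith [Real.pi_pos]
  have h2θ : 2 * (Real.sin (π * p / (2 * q)) / θ) - 1 + Real.cos (π * p / (2 * q)) =
      (4 * q * m : ℕ) / π * Real.sin (π * p / (2 * q)) - 1 + Real.cos (π * p / (2 * q)) := by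
    rw [hθdef]; push_cast; field_simp
  have hsummand : ∀ j : ℕ, Real.cos (2 * π * j / (4 * q * m : ℕ)) = Real.cos (θ * j) := fun j => by
    rw [hθdef]; ring_nf
  simp_rw [hsummand]
  have hdisj : Disjoint (Finset.range (p * m)) (Finset.Ico (4 * q * m - p * m) (4 * q * m)) :=
    Finset.disjoint_left.2 fun j h1 h2 => by
      have := Finset.mem_range.1 h1; have := (Finset.mem_Ico.1 h2).1
      have : 2 * (p * m) ≤ 4 * q * m := by nlinarith
      omega
  rw [Finset.sum_union hdisj]
  have hanti : AntitoneOn (fun u : ℝ => Real.cos (θ * u)) (Icc (0 : ℝ) (0 + ((p * m : ℕ) : ℝ))) := by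
    intro x hx y hy hxy
    simp only [zero_add] at hx hy
    refine Real.cos_le_cos_of_nonneg_of_le_pi (by nlinarith [hx.1, hθ.le]) ?_
      (mul_le_mul_of_nonneg_left hxy hθ.le)
    calc θ * y ≤ θ * ((p * m : ℕ) : ℝ) := mul_le_mul_of_nonneg_left hy.2 hθ.le
      _ = π * p / (2 * q) := hθpm
      _ ≤ π := hkFπ
  have hint : ∫ u in (0 : ℝ)..(0 + ((p * m : ℕ) : ℝ)), Real.cos (θ * u) = Real.sin (π * p / (2 * q)) / θ := by
    have h := intervalIntegral.integral_comp_mul_left (fun x => Real.cos x) hθ.ne' (a := 0)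
      (b := ((p * m : ℕ) : ℝ))
    simp only [mul_zero] at h
    rw [zero_add, h, hθpm, integral_cos, Real.sin_zero, smul_eq_mul]
    ring
  have hA : Real.sin (π * p / (2 * q)) / θ ≤ ∑ j ∈ Finset.range (p * m), Real.cos (θ * j) := by
    have h := hanti.integral_le_sum
    beta_reduce at h
    rw [hint] at h
    simpa using h
  have hB : ∑ j ∈ Finset.Ico (4 * q * m - p * m) (4 * q * m), Real.cos (θ * j) =
      ∑ j ∈ Finset.range (p * m), Real.cos (θ * j) - 1 + Real.cos (π * p / (2 * q)) := by
    have hle : p * m + 1 ≤ 4 * q * m + 1 := by nlinarith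
    have hrefl := Finset.sum_Ico_reflect (fun j : ℕ => Real.cos (θ * j)) 1 (m := p * m + 1) (n := 4 * q * m)
      hle
    beta_reduce at hrefl
    rw [show 4 * q * m + 1 - (p * m + 1) = 4 * q * m - p * m by omega,
      show 4 * q * m + 1 - 1 = 4 * q * m by omega] at hrefl
    rw [← hrefl]
    have hper : ∀ j ∈ Finset.Ico 1 (p * m + 1),
        Real.cos (θ * ((4 * q * m - j : ℕ) : ℝ)) = Real.cos (θ * j) := by
      intro j hj
      have hj4 : j ≤ 4 * q * m := by
        have := (Finset.mem_Ico.1 hj).2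
        have : 2 * (p * m) ≤ 4 * q * m := by nlinarith
        omega
      rw [Nat.cast_sub hj4, mul_sub]
      have h4 : θ * ((4 * q * m : ℕ) : ℝ) = 2 * π := by rw [hθdef]; field_simp
      rw [h4, show 2 * π - θ * (j : ℝ) = -(θ * (j : ℝ) - 2 * π) by ring, Real.cos_neg,
        Real.cos_sub_two_pi]
    have hcm : Real.cos (θ * ((p * m : ℕ) : ℕ)) = Real.cos (π * p / (2 * q)) := by rw [hθpm]
    have hc0 : Real.cos (θ * (0 : ℕ)) = 1 := by simp
    rw [Finset.sum_congr rfl hper, Finset.sum_Ico_succ_top hpm, hcm, Finset.range_eq_Ico,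
      Finset.sum_eq_sum_Ico_succ_bot hpm, hc0]
    ring
  rw [hB, ← h2θ]
  linarith

/-- **Free-fermion upper bound on the rings `L = 4qm'`, `N = 4pm'`** (`1 ≤ p ≤ 2q`, `t ≥ 0`, `U = 0`):
`E_L(N) ≤ -4t ((L/π) sin k_F - 1 + cos k_F)`, `k_F = πp/(2q)`. [cite: LiebWuPhysicaA2003, §4 and §6 Remark (A)] -/
theorem hubbardChain_groundEnergyAt_zero_filling_le {p q : ℕ} (hp1 : 1 ≤ p) (hp : p ≤ 2 * q) (m : ℕ)
    (hm : 1 ≤ m) {Lr Nr : ℕ} (hLr : Lr = 4 * q * m) (hNr : Nr = 4 * p * m) {t : ℝ} (ht : 0 ≤ t) :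
    groundEnergyAt (fermionTorusGraph 1 Lr) t 0 Nr ≤
      -(4 * t) * ((4 * q * m : ℕ) / π * Real.sin (π * p / (2 * q)) - 1 + Real.cos (π * p / (2 * q))) := by
  rw [hubbardChain_groundEnergyAt_zero_filling_eq hp1 hp m hm hLr hNr ht, hLr]
  exact mul_le_mul_of_nonpos_left (fermiSum_filling_ge hp1 hp m hm) (by linarith)

/-- **The Hubbard chain at `U = 0` and filling `n = p/q` (`1 ≤ p ≤ 2q`): `e(t, 0; p/q) = -(4t/π) sin(πp/(2q))`**
(`t ≥ 0`) — the free-fermion ground-state energy density `-(4t/π) sin(πn/2)` at every rational density,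
as the value of the tree's thermodynamic limit `ThermodynamicLimit.hubbardChainEnergyDensityAt t 0 p q`
(`lim_m E_{qm}(pm)/(qm)`). Upper bound along the rings `L = 4qm'`
(`hubbardChain_groundEnergyAt_zero_filling_le`, `hubbardChainEnergyDensityAt_le_of_le`); lower bound on
every ring from the bathtub bound at `k_F = πp/(2q)` (`hubbardChain_groundEnergyAt_zero_ge_fermi`,
`hubbardChainEnergyDensityAt_ge_of_forall_ge`), where `μn` cancels against `(4t/π)·k_F cos k_F`. The
`U = 0` case of Lieb–Wu's `E = -2N_a∫_{-Q}^{Q} ρ(k) cos k dk` with the ideal-Fermi-gas density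
`ρ = 1/(2π)` per spin on `|k| < Q = πn/2` (2003, §4 and §6 Remark (A)).
[cite: LiebWuPhysicaA2003, §4 and §6 Remark (A)] -/
theorem hubbardChainEnergyDensityAt_zero {p q : ℕ} (hp1 : 1 ≤ p) (hp : p ≤ 2 * q) {t : ℝ} (ht : 0 ≤ t) :
    hubbardChainEnergyDensityAt t 0 p q = -(4 * t) / π * Real.sin (π * p / (2 * q)) := by
  have hq : 1 ≤ q := by omega
  have hqr : (0 : ℝ) < q := by exact_mod_cast hq
  have hkF0 : 0 ≤ π * p / (2 * q) := by positivity
  have hkFπ : π * p / (2 * q) ≤ π := by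
    rw [div_le_iff₀ (by positivity)]
    have : (p : ℝ) ≤ 2 * q := by exact_mod_cast hp
    nlinarith [Real.pi_pos]
  have hsin0 : 0 ≤ Real.sin (π * p / (2 * q)) := Real.sin_nonneg_of_nonneg_of_le_pi hkF0 hkFπ
  have hcos1 : Real.cos (π * p / (2 * q)) ≤ 1 := Real.cos_le_one _
  have hcosm1 : -1 ≤ Real.cos (π * p / (2 * q)) := Real.neg_one_le_cos _
  refine le_antisymm ?_ ?_
  · refine le_of_forall_pos_le_add fun ε hε => ?_
    obtain ⟨m, hm⟩ := exists_nat_gt (4 * t / ε)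
    have hM : (0 : ℝ) < ((m + 1 : ℕ) : ℝ) := by positivity
    have hE := hubbardChain_groundEnergyAt_zero_filling_le hp1 hp (m + 1) (by omega)
      (Lr := q * (4 * (m + 1))) (Nr := p * (4 * (m + 1))) (by ring) (by ring) ht
    have h := hubbardChainEnergyDensityAt_le_of_le t (le_refl (0 : ℝ)) (p := p) (q := q) hq hp
      (m := 4 * (m + 1)) (by omega) hE
    rw [abs_of_nonneg ht] at h
    have hcalc : -(4 * t) * (((4 * q * (m + 1) : ℕ) : ℝ) / π * Real.sin (π * p / (2 * q)) - 1 +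
        Real.cos (π * p / (2 * q))) / ((q * (4 * (m + 1)) : ℕ) : ℝ) + 8 * t / ((q * (4 * (m + 1)) : ℕ) : ℝ) =
        -(4 * t) / π * Real.sin (π * p / (2 * q)) +
          (12 - 4 * Real.cos (π * p / (2 * q))) * t / (4 * q * ((m + 1 : ℕ) : ℝ)) := by
      push_cast; field_simp; ring
    rw [hcalc] at h
    have h3 : (12 - 4 * Real.cos (π * p / (2 * q))) * t / (4 * q * ((m + 1 : ℕ) : ℝ)) ≤ ε := by
      rw [div_le_iff₀ (by positivity)]
      have h' : 4 * t / ε < m := hm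
      rw [div_lt_iff₀ hε] at h'
      have hm1 : (m : ℝ) ≤ ((m + 1 : ℕ) : ℝ) := by push_cast; linarith
      have hq1 : (1 : ℝ) ≤ q := by exact_mod_cast hq
      nlinarith [h', hm1, hε.le, hcosm1, ht, hq1, mul_nonneg ht hε.le,
        mul_le_mul_of_nonneg_left hq1 (by positivity : (0:ℝ) ≤ ε * ((m + 1 : ℕ) : ℝ))]
    linarith
  · refine le_of_forall_pos_le_add fun ε hε => ?_
    obtain ⟨m₀, hm₀⟩ := exists_nat_gt (8 * t / ε)
    have key : ∀ m : ℕ, m₀ + 3 ≤ m →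
        -(4 * t) / π * Real.sin (π * p / (2 * q)) - ε ≤
          groundEnergyAt (fermionTorusGraph 1 (q * m)) t 0 (p * m) / ((q * m : ℕ) : ℝ) := by
      intro m hmm
      have hqm3 : 3 ≤ q * m := by nlinarith
      haveI : NeZero (q * m) := ⟨by omega⟩
      have hLpos : (0 : ℝ) < ((q * m : ℕ) : ℝ) := by exact_mod_cast (by omega : 0 < q * m)
      have hmr : (0 : ℝ) < m := by exact_mod_cast (by omega : 0 < m)
      have hE := hubbardChain_groundEnergyAt_zero_ge_fermi (L := q * m) hqm3 ht (N := p * m)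
        (by nlinarith) hkF0 hkFπ
      rw [le_div_iff₀ hLpos]
      have hεm : 8 * t ≤ ε * m := by
        have h1 : 8 * t / ε < m₀ := hm₀
        rw [div_lt_iff₀ hε] at h1
        have h2 : (m₀ : ℝ) ≤ m := by exact_mod_cast (by omega : m₀ ≤ m)
        nlinarith [h1, h2, hε.le]
      have hid : (-(4 * t) / π * Real.sin (π * p / (2 * q)) - ε) * ((q * m : ℕ) : ℝ) =
          -(2 * t * Real.cos (π * p / (2 * q))) * ((p * m : ℕ) : ℝ) -
            4 * t * (((q * m : ℕ) : ℝ) / π * (Real.sin (π * p / (2 * q)) -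
              π * p / (2 * q) * Real.cos (π * p / (2 * q))) + (1 - Real.cos (π * p / (2 * q))))
            + (4 * t * (1 - Real.cos (π * p / (2 * q))) - ε * q * m) := by
        push_cast; field_simp; ring
      rw [hid]
      have hq1 : (1 : ℝ) ≤ q := by exact_mod_cast hq
      nlinarith [hE, hεm, hcosm1, ht, hq1, mul_le_mul_of_nonneg_left hq1 (by positivity : (0:ℝ) ≤ ε * m)]
    have h := hubbardChainEnergyDensityAt_ge_of_forall_ge t (le_refl (0 : ℝ)) (p := p) (q := q) hq hp
      (m₀ + 3) key
    linarith

end FreeFermionChain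

end Literature.MathematicalPhysics.QuantumLattice
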